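import Mathlib.Data.Matrix.Basis
import Mathlib.NumberTheory.Padics.RingHoms
import Mathlib.Topology.Instances.ZMod
import Mathlib.Topology.Instances.Matrix
import Mathlib.LinearAlgebra.Matrix.NonsingularInverse
import Mathlib.Topology.LocallyConstant.Basic
import Mathlib.LinearAlgebra.Matrix.Trace
import Literature.NumberTheory.FaltingsSerre.Criterion
import Literature.RepresentationTheory.Semisimple.BurnsideMatrixSpan
import Literature.NumberTheory.GaloisRepresentations.ResidualGaloisRep
import Literature.NumberTheory.GaloisRepresentations.CarayolSerreLemmasProofs
import Literature.NumberTheory.GaloisRepresentations.LocalOneUnitsProofs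
import HarnessLib

/-!
# The Faltings–Serre method after Brumer–Pacetti–Poor–Tornaría–Voight–Yuen, III: the criterion holds

This file DISCHARGES the named facts `Literature.NumberTheory.FaltingsSerre.traceEq_of_faltingsSerre`
and `Literature.NumberTheory.FaltingsSerre.traceEq_of_faltingsSerre_symplectic` of `Criterion.lean` —
[BPPTVY] = A. Brumer, A. Pacetti, C. Poor, G. Tornaría, J. Voight, D. S. Yuen, *On the paramodularity
of typical abelian surfaces*, Algebra & Number Theory **13**:5 (2019) 1145–1195, Theorem 2.1.5
(p. 1150) in the form of the correctness of Algorithm 2.4.1 (pp. 1156–1157), case `G = GL_n`, and its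
refinement for `G = GSp(J)` (Lemma 2.3.20 / Remark 2.4.2, p. 1156, typed with equal multipliers) — by
`traceEq_of_faltingsSerre_holds` and `traceEq_of_faltingsSerre_symplectic_holds` (PRINTED numbering and
pages throughout).  The second is the hypothesis `hFS` of `ParamodularCertificate.paramodular_of_certificate`,
`ParamodularTemplate.paramodular_of_surfaceCertificate` and `Paramodular277.paramodular_277`, which are
thereby unconditional in the criterion.

We follow the printed proof.  Its architecture (pp. 1152–1157) is:

1. [Lemma 2.3.6(a), (2.3.5)] if `ρ₁ ≡ ρ₂ (mod ℓ^r)`, `r ≥ 1`, write `ρ₁(σ) = (1 + ℓ^r μ(σ)) ρ₂(σ)`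
   (mod `ℓ^{r+1}`); then `μ mod ℓ` is a deviation cocycle of the common residual representation `ρ̄`
   (`stage_cocycle`; the bookkeeping identity is `stage_E_mul`);
2. [Prop. 2.3.14(c), (2.3.15)] `utr φ_μ(σ) = tr(μ(σ)ρ̄(σ)) ≡ (tr ρ₁(σ) - tr ρ₂(σ))/ℓ^r (mod ℓ)`, so an
   element at which the traces agree is not obstructing (`stage_trace`);
3. [Cor. 2.3.19] for `ρ̄` absolutely irreducible, `μ` is a coboundary iff `φ_μ` is not obstructing
   (`isDeviationCoboundary_of_forall_trace_eq_zero`, `isObstructing_of_not_isDeviationCoboundary`;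
   the direction "coboundary ⇒ not obstructing" is `Deviation.not_isObstructing_of_isDeviationCoboundary`);
4. [Lemma 2.3.6(b)] if `μ ≡ a - ρ̄ a ρ̄⁻¹` is a coboundary then `P = 1 + ℓ^r A` (`A` a lift of `a`)
   satisfies `ρ₁ P ≡ P ρ₂ (mod ℓ^{r+1})` (`stage_conj`);
5. [proof of correctness of Algorithm 2.4.1, pp. 1156–1157] "assume for purposes of contradiction that
   `ρ₁ ≄ ρ₂`.  Then there exists `r ≥ 1` such that `ρ₁ ≃ ρ₂ (mod ℓ^r)` but `ρ₁ ≄ ρ₂ (mod ℓ^{r+1})` …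
   by Corollary 2.3.19 `φ_μ` … is obstructing … there is a prime `𝔭` in Step 4 such that
   `utr φ_μ(Frob_𝔭) ≢ 0 (mod ℓ)`.  But then by (2.3.15) we would have `tr ρ₁(Frob_𝔭) ≢ tr ρ₂(Frob_𝔭)`,
   contradicting the verification carried out in Step 5."  Here this is run as an INDUCTION on `r`
   (`traceEq_of_faltingsSerre_holds`): from `P` with `ρ₁ P ≡ P ρ₂ (mod ℓ^r)` the deviation cocycle of
   `(ρ₁, Pρ₂P⁻¹)` is, by 2–3 and the hypotheses `complete`/`traces`, a coboundary
   (`stage_coboundary`), and 4 improves `P` to `(1 + ℓ^r A)P`; hence `tr ρ₁ ≡ tr ρ₂ (mod ℓ^r)` for all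
   `r`, i.e. `tr ρ₁ = tr ρ₂` (`ℤ_ℓ` is `ℓ`-adically separated, `PadicInt.ext_of_toZModPow`).

Deviations from the printed text.  (i) The printed proof of Cor. 2.3.19 (⇐) passes through
`tr ρ₁ ≡ tr ρ₂ (mod ℓ^{r+1})`, Carayol's theorem (Thm. 2.1.4) over `ℤ/ℓ^{r+1}` and Lemma 2.3.6(b)
(with Schur's lemma modulo `ℓ^r`); here the same statement — a deviation cocycle `μ` of an absolutely
irreducible `ρ̄` with `tr(μ(σ)ρ̄(σ)) = 0` for all `σ` is a coboundary — is proved directly over the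
field: with `c(σ) = μ(σ)ρ̄(σ)` one has `c(στ) = c(σ)ρ̄(τ) + ρ̄(σ)c(τ)`, the span of the pairs
`(ρ̄(σ), c(σ))` is (Burnside, `Literature.RepresentationTheory.Semisimple.span_eq_top_iff_forall_isIrreducible`,
and the non-degeneracy of the trace form, `CarayolSerre.eq_zero_of_forall_trace_mul_eq_zero`) the graph
of a derivation of `M_n(k)`, and every derivation of `M_n(k)` is inner (`exists_eq_mul_sub_mul_of_leibniz`,
the vanishing of the first Hochschild cohomology of a matrix algebra, [folklore]).  (ii) The maximal `r`
of the printed proof by contradiction is replaced by the induction 5, which constructs the conjugating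
matrices `P` explicitly and never needs Carayol's theorem.  (iii) As in `Criterion.lean`, `Gal_{F,S}` is
an arbitrary topological group with "inertia" `I` and "Frobenius elements" `T`; the locally constant
cocycles of the binder `complete` are exactly what two CONTINUOUS `ρᵢ` produce
(`stage_isLocallyConstant`).

The symplectic refinement (`traceEq_of_faltingsSerre_symplectic_holds`).  [BPPTVY, Remark 2.4.2]: "if we
know that `det ρ₁ = det ρ₂`, then we can replace `Lie(G)` by `Lie⁰(G)`"; as explained in
`Criterion.lean`/`Deviation.gspLie_ne_spLie_char_two`, for `GSp₄(𝔽₂)` the reduction to `𝔰𝔭`-valued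
cocycles must come from the equality of the MULTIPLIERS of `ρ₁, ρ₂`, and the printed text leaves
implicit that the conjugation "we may assume `ρ₁ ≡ ρ₂ (mod ℓ^r)`" can be done inside `GSp`.  Here this
is made explicit without Hensel's lemma: the induction carries, besides `ρ₁ P ≡ P ρ₂ (mod ℓ^r)`, the
congruence `Pᵀ J P ≡ λ J (mod ℓ^{r+1})`.  Then (6) the deviation cocycle is `𝔰𝔭(J̄)`-valued
(`sp_deviation_mem_spLie`: compare `(ρ₁P)ᵀ J (ρ₁P) = ν PᵀJP` with the expansion of
`(Pρ₂ + ℓ^r N)ᵀ J (Pρ₂ + ℓ^r N)`); (7) a coboundary witness `a` of an `𝔰𝔭(J̄)`-valued cocycle lies in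
`𝔤𝔰𝔭(J̄)`, `aᵀJ̄ + J̄a = cJ̄` (`exists_transpose_mul_add_mul_eq_smul`: `ρ̄ᵀ(aᵀJ̄ + J̄a)ρ̄ = ν̄(aᵀJ̄ + J̄a)`,
so `J̄⁻¹(aᵀJ̄ + J̄a)` commutes with `ρ̄(Γ)` and is scalar by Schur/Burnside); (8) the lift `A = A₀ + ℓA₁`
of `a` is CHOSEN so that `P' = (1 + ℓ^r A)P` again satisfies `P'ᵀ J P' ≡ λ' J (mod ℓ^{r+2})`: the
obstruction is an alternating matrix `G` over `𝔽_ℓ` (alternating = `U - Uᵀ`, equivalently skew with zero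
diagonal, `exists_eq_sub_transpose`; this is where `Jᵀ = -J` AND `J_{ii} = 0` are used, both needed in
characteristic `2`) and `A₁ᵀ J̄ + J̄ A₁ = G` is solvable for alternating `G` and invertible skew `J̄`
(`exists_transpose_mul_add_mul_eq`, `A₁ = J̄⁻¹U`); the bookkeeping is `sp_step`.  So for `GSp(J)` with
`J` alternating of unit determinant, "Schur modulo `ℓ^r` + smoothness of `GSp`" is replaced by this
explicit linear algebra; nothing beyond [BPPTVY, §2.3] is cited.

## References

* [BPPTVY] A. Brumer, A. Pacetti, C. Poor, G. Tornaría, J. Voight, D. S. Yuen, Algebra & Number Theory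
  13:5 (2019) 1145–1195, doi:10.2140/ant.2019.13.1145: Thm. 2.1.5 (p. 1150), §2.3: (2.3.2)–(2.3.5),
  Lemma 2.3.6 (p. 1153), Prop. 2.3.14 (p. 1154), (2.3.15), Def. 2.3.18, Cor. 2.3.19 (p. 1155),
  Lemma 2.3.20, Algorithm 2.4.1 and its proof of correctness, Remark 2.4.2 (pp. 1156–1157); (5.1.2)–(5.1.4)
  p. 1173. [cite: BrumerEtAl2019]
* B. Mazur, *An introduction to the deformation theory of Galois representations* (1997), Ch. II §4
  (Schur, Burnside–Nakayama) — the tree files `CarayolSerreLemmas(Proofs)`. [cite: Mazur1997Deformation]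
-/

namespace Literature.NumberTheory.FaltingsSerre

open Matrix Literature.NumberTheory.GaloisRepresentations

section Inner

variable {k : Type*} [CommRing k]

/-- `E_{0p} * x = ∑ j, x_{pj} E_{0j}`: left multiplication by the matrix unit `E_{0p}` moves row
`p` of `x` to row `0`. [folklore] -/
theorem single_zero_mul_eq_sum {m : ℕ} (x : Matrix (Fin (m + 1)) (Fin (m + 1)) k) (p : Fin (m + 1)) :
    Matrix.single (0 : Fin (m + 1)) p (1 : k) * x =
      ∑ j, x p j • Matrix.single (0 : Fin (m + 1)) j (1 : k) := by
  ext a b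
  rw [Matrix.sum_apply]
  simp only [Matrix.mul_apply, Matrix.single_apply, Matrix.smul_apply, smul_eq_mul, ite_mul, one_mul,
    zero_mul, ite_and, mul_ite, mul_one, mul_zero]
  by_cases ha : (0 : Fin (m + 1)) = a <;> simp [ha]

/-- **Every `k`-linear derivation of `M_n(k)` into itself is inner** (`n ≥ 1`): if
`δ(XY) = δ(X) Y + X δ(Y)` then `δ(X) = M X - X M` with `M = ∑ j, δ(E_{j0}) E_{0j}`.  Indeed
`δ(X) = ∑ j δ(X) E_{j0} E_{0j} = ∑ j (δ(X E_{j0}) - X δ(E_{j0})) E_{0j}` and `∑ j δ(X E_{j0}) E_{0j} = M X`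
(both sides are linear in `X` and agree on matrix units).  (First Hochschild cohomology of a matrix
algebra with coefficients in itself vanishes.) [folklore] -/
theorem exists_eq_mul_sub_mul_of_leibniz {m : ℕ}
    (δ : Matrix (Fin (m + 1)) (Fin (m + 1)) k →ₗ[k] Matrix (Fin (m + 1)) (Fin (m + 1)) k)
    (hδ : ∀ X Y, δ (X * Y) = δ X * Y + X * δ Y) :
    ∃ M : Matrix (Fin (m + 1)) (Fin (m + 1)) k, ∀ X, δ X = M * X - X * M := by
  refine ⟨∑ j, δ (Matrix.single j 0 1) * Matrix.single 0 j 1, fun X => ?_⟩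
  -- Claim 1: `δ X = ∑ j δ(X E_{j0}) E_{0j} - X M`
  have h1 : δ X = ∑ j, δ (X * Matrix.single j 0 1) * Matrix.single 0 j 1 -
      X * ∑ j, δ (Matrix.single j 0 1) * Matrix.single 0 j 1 := by
    have hX : δ X = δ X * ∑ j, Matrix.single j (0 : Fin (m + 1)) (1 : k) * Matrix.single 0 j 1 := by
      simp only [Matrix.single_mul_single_same, mul_one, Matrix.sum_single_one]
    rw [hX, Finset.mul_sum, Finset.mul_sum, ← Finset.sum_sub_distrib]
    refine Finset.sum_congr rfl fun j _ => ?_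
    rw [← Matrix.mul_assoc (δ X), hδ, Matrix.add_mul]
    simp only [Matrix.mul_assoc, add_sub_cancel_right]
  -- Claim 2: `∑ j δ(X E_{j0}) E_{0j} = M X`
  have h2 : ∑ j, δ (X * Matrix.single j 0 1) * Matrix.single 0 j 1 =
      (∑ j, δ (Matrix.single j 0 1) * Matrix.single 0 j 1) * X := by
    have hL : ∑ j, δ (X * Matrix.single j 0 1) * Matrix.single 0 j 1 =
        ∑ j, ∑ i, X i j • (δ (Matrix.single i 0 1) * Matrix.single 0 j 1) := by
      refine Finset.sum_congr rfl fun j _ => ?_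
      rw [CarayolSerre.mul_single_zero_one X j, map_sum, Finset.sum_mul]
      refine Finset.sum_congr rfl fun i _ => ?_
      rw [map_smul, smul_mul_assoc]
    have hR : (∑ j, δ (Matrix.single j 0 1) * Matrix.single 0 j 1) * X =
        ∑ j, ∑ i, X j i • (δ (Matrix.single j 0 1) * Matrix.single 0 i 1) := by
      rw [Finset.sum_mul]
      refine Finset.sum_congr rfl fun j _ => ?_
      rw [Matrix.mul_assoc, single_zero_mul_eq_sum X j, Finset.mul_sum]
      refine Finset.sum_congr rfl fun i _ => ?_
      rw [Matrix.mul_smul]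
    rw [hL, hR, Finset.sum_comm]
  rw [h1, h2]

end Inner

/-! ### Cor. 2.3.19 (⇐): a non-obstructing deviation cocycle of an absolutely irreducible `ρ̄` is a coboundary -/

section Coboundary

universe u

variable {k : Type u} [Field k] {Γ : Type*} [Group Γ] {n : ℕ}

/-- **[BPPTVY, Prop. 2.3.14(b)/Cor. 2.3.19, direction (⇐)] over a field**: if `ρ̄ : Γ → GL_n(k)` is
absolutely irreducible and `μ` is a deviation cocycle of `ρ̄` with `utr φ_μ ≡ 0`, i.e.
`tr(μ(σ)ρ̄(σ)) = 0` for all `σ`, then `μ` is a coboundary.  The printed proof (p. 1155) passes through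
`tr ρ₁ ≡ tr ρ₂ (mod ℓ^{r+1})`, Carayol's theorem over `ℤ/ℓ^{r+1}` and Lemma 2.3.6(b); here the same
statement is proved directly over `k`: with `c(σ) = μ(σ)ρ̄(σ)` one has `c(στ) = c(σ)ρ̄(τ) + ρ̄(σ)c(τ)`;
the `k`-span `S` of the pairs `(ρ̄(σ), c(σ))` is, by Burnside (`k⟨ρ̄(Γ)⟩ = M_n(k)`) and the
non-degeneracy of the trace form, the graph of a derivation `δ` of `M_n(k)`; every such derivation is
inner, `δ(X) = MX - XM` (`exists_eq_mul_sub_mul_of_leibniz`), whence `μ(σ) = M - ρ̄(σ)Mρ̄(σ)⁻¹`.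
[cite: BrumerEtAl2019, Prop. 2.3.14(b) and Cor. 2.3.19 p. 1155] -/
theorem isDeviationCoboundary_of_forall_trace_eq_zero (ρbar : Γ →* GL (Fin n) k)
    (hirr : IsAbsIrreducible ρbar) {μ : Γ → Matrix (Fin n) (Fin n) k}
    (hμ : IsDeviationCocycle ρbar μ)
    (h : ∀ σ, Matrix.trace (μ σ * (ρbar σ : Matrix (Fin n) (Fin n) k)) = 0) :
    IsDeviationCoboundary ρbar μ := by
  rcases Nat.eq_zero_or_pos n with rfl | hn
  · exact ⟨0, fun σ => Subsingleton.elim _ _⟩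
  obtain ⟨m, rfl⟩ : ∃ m, n = m + 1 := ⟨n - 1, by omega⟩
  have hspan := (Literature.RepresentationTheory.Semisimple.span_eq_top_iff_forall_isIrreducible hn ρbar).2 hirr
  -- `c σ = μ σ ρ̄ σ` and its Leibniz identity
  set c : Γ → Matrix (Fin (m + 1)) (Fin (m + 1)) k :=
    fun σ => μ σ * (ρbar σ : Matrix (Fin (m + 1)) (Fin (m + 1)) k) with hc
  have hcmul : ∀ σ τ, c (σ * τ) = c σ * (ρbar τ : Matrix (Fin (m + 1)) (Fin (m + 1)) k) +
      (ρbar σ : Matrix (Fin (m + 1)) (Fin (m + 1)) k) * c τ := by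
    intro σ τ
    simp only [hc, hμ σ τ, map_mul, Units.val_mul, Matrix.add_mul, Matrix.mul_assoc,
      Units.inv_mul_cancel_left]
  -- the span `S` of the pairs `(ρ̄ σ, c σ)`
  set S := Submodule.span k
    (Set.range fun g => (((ρbar g : GL (Fin (m + 1)) k) : Matrix (Fin (m + 1)) (Fin (m + 1)) k), c g))
    with hS
  have hS1 : ∀ z ∈ S, Matrix.trace z.2 = 0 := by
    intro z hz
    induction hz using Submodule.span_induction with
    | mem x hx =>
      obtain ⟨g, rfl⟩ := hx
      exact h g
    | zero => simp
    | add x y _ _ hx hy => rw [Prod.snd_add, Matrix.trace_add, hx, hy, add_zero]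
    | smul a x _ hx => rw [Prod.smul_snd, Matrix.trace_smul, hx, smul_zero]
  have hS2 : ∀ τ, ∀ z ∈ S, ((ρbar τ : Matrix (Fin (m + 1)) (Fin (m + 1)) k) * z.1,
      c τ * z.1 + (ρbar τ : Matrix (Fin (m + 1)) (Fin (m + 1)) k) * z.2) ∈ S := by
    intro τ z hz
    induction hz using Submodule.span_induction with
    | mem x hx =>
      obtain ⟨g, rfl⟩ := hx
      refine Submodule.subset_span ⟨τ * g, ?_⟩
      simp only [map_mul, Units.val_mul, hcmul]
    | zero =>
      simp only [Prod.fst_zero, Prod.snd_zero, Matrix.mul_zero, add_zero]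
      rw [Prod.mk_zero_zero]
      exact S.zero_mem
    | add x y _ _ hx hy =>
      have hxy := S.add_mem hx hy
      simp only [Prod.mk_add_mk] at hxy
      simp only [Prod.fst_add, Prod.snd_add, Matrix.mul_add]
      convert hxy using 2
      abel
    | smul a x _ hx =>
      have hax := S.smul_mem a hx
      simp only [Prod.smul_mk] at hax
      simp only [Prod.smul_fst, Prod.smul_snd, Matrix.mul_smul, ← smul_add]
      exact hax
  -- the first projection of `S` is injective (non-degeneracy of the trace form + Burnside)
  have hS4 : ∀ z ∈ S, z.1 = 0 → z.2 = 0 := by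
    intro z hz hz1
    refine CarayolSerre.eq_zero_of_forall_trace_mul_eq_zero _ fun b => ?_
    have hb : b ∈ Submodule.span k (Set.range fun g =>
        ((ρbar g : GL (Fin (m + 1)) k) : Matrix (Fin (m + 1)) (Fin (m + 1)) k)) := by
      rw [hspan]; exact Submodule.mem_top
    induction hb using Submodule.span_induction with
    | mem x hx =>
      obtain ⟨τ, rfl⟩ := hx
      have h2 := hS1 _ (hS2 τ z hz)
      simpa [hz1] using h2
    | zero => simp
    | add x y _ _ hx hy => rw [Matrix.add_mul, Matrix.trace_add, hx, hy, add_zero]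
    | smul a x _ hx => rw [Matrix.smul_mul, Matrix.trace_smul, hx, smul_zero]
  -- the first projection of `S` is onto
  have hS3 : ∀ X, ∃ Y, (X, Y) ∈ S := by
    intro X
    have hX : X ∈ Submodule.span k (Set.range fun g =>
        ((ρbar g : GL (Fin (m + 1)) k) : Matrix (Fin (m + 1)) (Fin (m + 1)) k)) := by
      rw [hspan]; exact Submodule.mem_top
    induction hX using Submodule.span_induction with
    | mem x hx =>
      obtain ⟨g, rfl⟩ := hx
      exact ⟨c g, Submodule.subset_span ⟨g, rfl⟩⟩
    | zero => exact ⟨0, by rw [Prod.mk_zero_zero]; exact S.zero_mem⟩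
    | add x y _ _ hx hy =>
      obtain ⟨Y, hY⟩ := hx
      obtain ⟨Y', hY'⟩ := hy
      exact ⟨Y + Y', by simpa using S.add_mem hY hY'⟩
    | smul a x _ hx =>
      obtain ⟨Y, hY⟩ := hx
      exact ⟨a • Y, by simpa using S.smul_mem a hY⟩
  have huniq : ∀ X Y Y', (X, Y) ∈ S → (X, Y') ∈ S → Y = Y' := by
    intro X Y Y' hY hY'
    have h0 := hS4 _ (S.sub_mem hY hY') (by simp)
    simpa [sub_eq_zero] using h0
  -- `S` is the graph of a linear map `δ`
  choose δ₀ hδ₀ using hS3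
  have hδ_add : ∀ X X', δ₀ (X + X') = δ₀ X + δ₀ X' := fun X X' =>
    huniq _ _ _ (hδ₀ _) (by simpa using S.add_mem (hδ₀ X) (hδ₀ X'))
  have hδ_smul : ∀ (a : k) X, δ₀ (a • X) = a • δ₀ X := fun a X =>
    huniq _ _ _ (hδ₀ _) (by simpa using S.smul_mem a (hδ₀ X))
  let δ : Matrix (Fin (m + 1)) (Fin (m + 1)) k →ₗ[k] Matrix (Fin (m + 1)) (Fin (m + 1)) k :=
    { toFun := δ₀, map_add' := hδ_add, map_smul' := hδ_smul }
  have hδapp : ∀ X, δ X = δ₀ X := fun X => rfl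
  have hδρ : ∀ g, δ (ρbar g : Matrix (Fin (m + 1)) (Fin (m + 1)) k) = c g := fun g =>
    huniq _ _ _ (hδ₀ _) (Submodule.subset_span ⟨g, rfl⟩)
  -- `δ` is a derivation
  have hleib : ∀ X Y, δ (X * Y) = δ X * Y + X * δ Y := by
    intro X Y
    have hX : X ∈ Submodule.span k (Set.range fun g =>
        ((ρbar g : GL (Fin (m + 1)) k) : Matrix (Fin (m + 1)) (Fin (m + 1)) k)) := by
      rw [hspan]; exact Submodule.mem_top
    induction hX using Submodule.span_induction with
    | mem x hx =>
      obtain ⟨τ, rfl⟩ := hx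
      have hmem := hS2 τ (Y, δ Y) (hδ₀ Y)
      rw [hδρ]
      exact huniq _ _ _ (hδ₀ _) hmem
    | zero => simp
    | add x y _ _ hx hy =>
      rw [Matrix.add_mul, map_add, hx, hy, map_add, Matrix.add_mul, Matrix.add_mul]
      abel
    | smul a x _ hx =>
      rw [Matrix.smul_mul, map_smul, hx, map_smul, smul_add, Matrix.smul_mul, Matrix.smul_mul]
  obtain ⟨M, hM⟩ := exists_eq_mul_sub_mul_of_leibniz δ hleib
  refine ⟨M, fun σ => ?_⟩
  have hμσ : μ σ = c σ * ((ρbar σ)⁻¹ : GL (Fin (m + 1)) k) := by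
    simp only [hc, Matrix.mul_assoc, Units.mul_inv, Matrix.mul_one]
  rw [hμσ, ← hδρ, hM, Matrix.sub_mul, Matrix.mul_assoc, Matrix.mul_assoc, Units.mul_inv, Matrix.mul_one]

/-- Equivalently: a deviation cocycle of an absolutely irreducible `ρ̄` that is not a coboundary is
obstructing (the direction of Cor. 2.3.19 used in the correctness proof of Algorithm 2.4.1, p. 1157:
"`μ ∉ B¹` … hence by Corollary 2.3.19 `φ_μ` … is obstructing"). [cite: BrumerEtAl2019, Cor. 2.3.19 p. 1155] -/
theorem isObstructing_of_not_isDeviationCoboundary (ρbar : Γ →* GL (Fin n) k)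
    (hirr : IsAbsIrreducible ρbar) {μ : Γ → Matrix (Fin n) (Fin n) k}
    (hμ : IsDeviationCocycle ρbar μ) (h : ¬ IsDeviationCoboundary ρbar μ) : IsObstructing ρbar μ := by
  by_contra hob
  refine h (isDeviationCoboundary_of_forall_trace_eq_zero ρbar hirr hμ fun σ => ?_)
  by_contra hσ
  exact hob ⟨σ, hσ⟩

/-- **Schur's lemma, span form**: if the `ρ̄(σ)` span `M_n(k)` (Burnside) then a matrix commuting with
every `ρ̄(σ)` is scalar. [folklore] -/
theorem exists_eq_smul_one_of_forall_comm (ρbar : Γ →* GL (Fin n) k)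
    (hspan : Submodule.span k (Set.range fun g =>
      ((ρbar g : GL (Fin n) k) : Matrix (Fin n) (Fin n) k)) = ⊤)
    (X : Matrix (Fin n) (Fin n) k)
    (hX : ∀ g, ((ρbar g : GL (Fin n) k) : Matrix (Fin n) (Fin n) k) * X =
      X * ((ρbar g : GL (Fin n) k) : Matrix (Fin n) (Fin n) k)) :
    ∃ c : k, X = c • (1 : Matrix (Fin n) (Fin n) k) := by
  have hall : ∀ Y : Matrix (Fin n) (Fin n) k, Y * X = X * Y := by
    intro Y
    have hY : Y ∈ Submodule.span k (Set.range fun g =>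
        ((ρbar g : GL (Fin n) k) : Matrix (Fin n) (Fin n) k)) := by
      rw [hspan]; exact Submodule.mem_top
    induction hY using Submodule.span_induction with
    | mem x hx =>
      obtain ⟨g, rfl⟩ := hx
      exact hX g
    | zero => simp
    | add x y _ _ hx hy => rw [Matrix.add_mul, Matrix.mul_add, hx, hy]
    | smul a x _ hx => rw [Matrix.smul_mul, Matrix.mul_smul, hx]
  obtain ⟨c, hc⟩ := Matrix.mem_range_scalar_of_commute_single (M := X) fun i j _ => hall _
  refine ⟨c, ?_⟩
  rw [← hc]
  ext i j
  by_cases hij : i = j <;> simp [hij]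

end Coboundary

/-! ### `ℓ`-adic bookkeeping: congruences of matrices over `ℤ_ℓ` -/

section Padic

variable {ℓ : ℕ} [Fact ℓ.Prime] {n : ℕ}

/-- `ℓ ≠ 0` in `ℤ_ℓ`. [folklore] -/
theorem natCast_ell_ne_zero : (ℓ : ℤ_[ℓ]) ≠ 0 := by
  exact_mod_cast (Fact.out : ℓ.Prime).ne_zero

/-- Cancellation of `ℓ^m` on matrices over the domain `ℤ_ℓ`. [folklore] -/
theorem smul_pow_cancel {m : ℕ} {X Y : Matrix (Fin n) (Fin n) ℤ_[ℓ]}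
    (h : ((ℓ : ℤ_[ℓ]) ^ m) • X = ((ℓ : ℤ_[ℓ]) ^ m) • Y) : X = Y := by
  ext i j
  have hij := congrFun (congrFun h i) j
  simp only [Matrix.smul_apply, smul_eq_mul] at hij
  exact mul_left_cancel₀ (pow_ne_zero m natCast_ell_ne_zero) hij

/-- `ℓ^m ≡ 0 (mod ℓ)` for `m ≥ 1`. [folklore] -/
theorem toZMod_ell_pow {m : ℕ} (hm : 1 ≤ m) : PadicInt.toZMod ((ℓ : ℤ_[ℓ]) ^ m) = 0 := by
  rw [map_pow, map_natCast, ZMod.natCast_self, zero_pow (by omega)]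

/-- `(ℓ^m X) mod ℓ = 0` for `m ≥ 1`. [folklore] -/
theorem map_toZMod_smul_pow {m : ℕ} (hm : 1 ≤ m) (X : Matrix (Fin n) (Fin n) ℤ_[ℓ]) :
    (((ℓ : ℤ_[ℓ]) ^ m) • X).map (PadicInt.toZMod (p := ℓ)) = 0 := by
  ext i j
  simp only [Matrix.map_apply, Matrix.smul_apply, smul_eq_mul, map_mul, toZMod_ell_pow hm, zero_mul,
    Matrix.zero_apply]

/-- A matrix over `ℤ_ℓ` that vanishes mod `ℓ` is `ℓ` times a matrix. [folklore] -/
theorem exists_eq_smul_of_map_toZMod_eq_zero (X : Matrix (Fin n) (Fin n) ℤ_[ℓ])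
    (h : X.map (PadicInt.toZMod (p := ℓ)) = 0) : ∃ Y : Matrix (Fin n) (Fin n) ℤ_[ℓ], X = (ℓ : ℤ_[ℓ]) • Y := by
  have hx : ∀ i j, ∃ y : ℤ_[ℓ], X i j = (ℓ : ℤ_[ℓ]) * y := by
    intro i j
    have hij : PadicInt.toZMod (X i j) = 0 := by
      have := congrFun (congrFun h i) j
      rwa [Matrix.map_apply] at this
    have hmem : X i j ∈ Ideal.span {(ℓ : ℤ_[ℓ])} := by
      rw [← PadicInt.maximalIdeal_eq_span_p, ← PadicInt.ker_toZMod]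
      exact hij
    obtain ⟨y, hy⟩ := Ideal.mem_span_singleton'.1 hmem
    exact ⟨y, by rw [← hy, mul_comm]⟩
  choose Y hY using hx
  exact ⟨Matrix.of Y, by ext i j; rw [Matrix.smul_apply, Matrix.of_apply, smul_eq_mul, hY]⟩

/-- Two matrices over `ℤ_ℓ` with the same reduction mod `ℓ^m` differ by `ℓ^m` times a matrix. [folklore] -/
theorem exists_sub_eq_smul_of_map_toZModPow_eq (m : ℕ) (X X' : Matrix (Fin n) (Fin n) ℤ_[ℓ])
    (h : X.map (PadicInt.toZModPow (p := ℓ) m) = X'.map (PadicInt.toZModPow (p := ℓ) m)) :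
    ∃ Y : Matrix (Fin n) (Fin n) ℤ_[ℓ], X - X' = ((ℓ : ℤ_[ℓ]) ^ m) • Y := by
  have hx : ∀ i j, ∃ y : ℤ_[ℓ], X i j - X' i j = (ℓ : ℤ_[ℓ]) ^ m * y := by
    intro i j
    have hij : PadicInt.toZModPow m (X i j) = PadicInt.toZModPow m (X' i j) := by
      have := congrFun (congrFun h i) j
      rwa [Matrix.map_apply, Matrix.map_apply] at this
    have hmem : X i j - X' i j ∈ Ideal.span {(ℓ : ℤ_[ℓ]) ^ m} := by
      rw [← PadicInt.ker_toZModPow, RingHom.mem_ker, map_sub, hij, sub_self]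
    obtain ⟨y, hy⟩ := Ideal.mem_span_singleton'.1 hmem
    exact ⟨y, by rw [← hy, mul_comm]⟩
  choose Y hY using hx
  exact ⟨Matrix.of Y, by ext i j; rw [Matrix.sub_apply, Matrix.smul_apply, Matrix.of_apply, smul_eq_mul, hY]⟩

/-- `1 + ℓ^m A` is invertible over `ℤ_ℓ` for `m ≥ 1` (its determinant is `≡ 1 (mod ℓ)`, a unit of
the local ring `ℤ_ℓ`). [folklore] -/
theorem isUnit_one_add_smul_pow {m : ℕ} (hm : 1 ≤ m) (A : Matrix (Fin n) (Fin n) ℤ_[ℓ]) :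
    IsUnit (1 + ((ℓ : ℤ_[ℓ]) ^ m) • A) := by
  rw [Matrix.isUnit_iff_isUnit_det]
  have hred : (1 + ((ℓ : ℤ_[ℓ]) ^ m) • A).map (PadicInt.toZMod (p := ℓ)) = 1 := by
    rw [Matrix.map_add _ (map_add _), map_toZMod_smul_pow hm, add_zero,
      Matrix.map_one _ (map_zero _) (map_one _)]
  have hdet : PadicInt.toZMod ((1 + ((ℓ : ℤ_[ℓ]) ^ m) • A).det) = 1 := by
    rw [RingHom.map_det, RingHom.mapMatrix_apply, hred, Matrix.det_one]
  by_contra hnu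
  have hmem : (1 + ((ℓ : ℤ_[ℓ]) ^ m) • A).det ∈ IsLocalRing.maximalIdeal ℤ_[ℓ] :=
    (IsLocalRing.mem_maximalIdeal _).2 hnu
  rw [← PadicInt.ker_toZMod, RingHom.mem_ker, hdet] at hmem
  exact one_ne_zero hmem

/-- An element of `ℤ_ℓ` divisible by every power of `ℓ` is `0`. [folklore] -/
theorem eq_zero_of_forall_mem_span_pow (x : ℤ_[ℓ]) (h : ∀ m : ℕ, x ∈ Ideal.span {(ℓ : ℤ_[ℓ]) ^ m}) :
    x = 0 :=
  PadicInt.ext_of_toZModPow.1 fun m => by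
    rw [map_zero, ← RingHom.mem_ker, PadicInt.ker_toZModPow]
    exact h m

/-- The reduction `ℤ_ℓ → 𝔽_ℓ` is continuous (discrete topology on `𝔽_ℓ`): its kernel is the open
unit ball. [folklore] -/
theorem continuous_toZMod : Continuous (PadicInt.toZMod (p := ℓ) : ℤ_[ℓ] → ZMod ℓ) := by
  refine continuous_of_continuousAt_zero (PadicInt.toZMod (p := ℓ)) ?_
  rw [ContinuousAt, map_zero, nhds_discrete (ZMod ℓ), Filter.tendsto_pure]
  have hb : Metric.ball (0 : ℤ_[ℓ]) 1 ∈ nhds (0 : ℤ_[ℓ]) := Metric.ball_mem_nhds _ one_pos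
  filter_upwards [hb] with x hx
  rw [Metric.mem_ball, dist_zero_right, ← PadicInt.mem_nonunits, ← IsLocalRing.mem_maximalIdeal,
    ← PadicInt.ker_toZMod, RingHom.mem_ker] at hx
  exact hx

/-- Lifting a matrix over `𝔽_ℓ` to `ℤ_ℓ` (entrywise, through the least residues). [folklore] -/
theorem exists_map_toZMod_eq (a : Matrix (Fin n) (Fin n) (ZMod ℓ)) :
    ∃ A : Matrix (Fin n) (Fin n) ℤ_[ℓ], A.map (PadicInt.toZMod (p := ℓ)) = a :=
  ⟨a.map fun x => ((x.val : ℕ) : ℤ_[ℓ]), by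
    ext i j
    rw [Matrix.map_apply, Matrix.map_apply, map_natCast, ZMod.natCast_zmod_val]⟩

end Padic

/-! ### One stage of the deformation argument: [BPPTVY, Lemma 2.3.6 and (2.3.15)] -/

section Stage

variable {ℓ : ℕ} [Fact ℓ.Prime] {Γ : Type*} [Group Γ] {n : ℕ}
variable (ρ₁ ρ₂ : Γ →* GL (Fin n) ℤ_[ℓ]) {r : ℕ} (E : Γ → Matrix (Fin n) (Fin n) ℤ_[ℓ])
  (hE : ∀ σ, ((ρ₁ σ : GL (Fin n) ℤ_[ℓ]) : Matrix (Fin n) (Fin n) ℤ_[ℓ]) -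
    ((ρ₂ σ : GL (Fin n) ℤ_[ℓ]) : Matrix (Fin n) (Fin n) ℤ_[ℓ]) = ((ℓ : ℤ_[ℓ]) ^ r) • E σ)

include hE

/-- If `ρ₁ ≡ ρ₂ (mod ℓ^r)`, `r ≥ 1`, the residual representations agree. [cite: BrumerEtAl2019, §2.3 p. 1153] -/
theorem stage_residual_eq (hr : 1 ≤ r) : residual ρ₂ = residual ρ₁ := by
  refine MonoidHom.ext fun σ => Units.ext ?_
  rw [residual_apply_coe, residual_apply_coe]
  have h : (((ρ₁ σ : GL (Fin n) ℤ_[ℓ]) : Matrix (Fin n) (Fin n) ℤ_[ℓ]) -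
      ((ρ₂ σ : GL (Fin n) ℤ_[ℓ]) : Matrix (Fin n) (Fin n) ℤ_[ℓ])).map (PadicInt.toZMod (p := ℓ)) =
      (((ℓ : ℤ_[ℓ]) ^ r) • E σ).map (PadicInt.toZMod (p := ℓ)) := by
    rw [hE σ]
  rw [Matrix.map_sub _ (map_sub _), map_toZMod_smul_pow hr, sub_eq_zero] at h
  exact h.symm

/-- `ρ₁ = ρ₂ + ℓ^r E`. [cite: BrumerEtAl2019, (2.3.5) p. 1153] -/
theorem stage_key (σ : Γ) :
    ((ρ₁ σ : GL (Fin n) ℤ_[ℓ]) : Matrix (Fin n) (Fin n) ℤ_[ℓ]) =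
      ((ρ₂ σ : GL (Fin n) ℤ_[ℓ]) : Matrix (Fin n) (Fin n) ℤ_[ℓ]) + ((ℓ : ℤ_[ℓ]) ^ r) • E σ := by
  rw [← hE σ]; abel

/-- The multiplicativity of `ρ₁, ρ₂` in terms of `E`: `E(στ) = E(σ)ρ₁(τ) + ρ₂(σ)E(τ)`
(the computation in the proof of Lemma 2.3.6(a)). [cite: BrumerEtAl2019, Lemma 2.3.6(a) p. 1153] -/
theorem stage_E_mul (σ τ : Γ) :
    E (σ * τ) = E σ * ((ρ₁ τ : GL (Fin n) ℤ_[ℓ]) : Matrix (Fin n) (Fin n) ℤ_[ℓ]) +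
      ((ρ₂ σ : GL (Fin n) ℤ_[ℓ]) : Matrix (Fin n) (Fin n) ℤ_[ℓ]) * E τ := by
  apply smul_pow_cancel (m := r)
  rw [← hE (σ * τ), smul_add, ← smul_mul_assoc, ← mul_smul_comm, ← hE σ, ← hE τ, map_mul, map_mul,
    Units.val_mul, Units.val_mul]
  noncomm_ring

/-- **[BPPTVY, Lemma 2.3.6(a)]: the deviation `μ(σ) = (E(σ)ρ₂(σ)⁻¹ mod ℓ)`, where
`ρ₁(σ) = (1 + ℓ^r E(σ)ρ₂(σ)⁻¹) ρ₂(σ)`, is a deviation cocycle of `ρ̄`.**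
[cite: BrumerEtAl2019, Lemma 2.3.6(a) p. 1153] -/
theorem stage_cocycle (hr : 1 ≤ r) :
    IsDeviationCocycle (residual ρ₁)
      (fun σ => (E σ * (((ρ₂ σ)⁻¹ : GL (Fin n) ℤ_[ℓ]) : Matrix (Fin n) (Fin n) ℤ_[ℓ])).map
        (PadicInt.toZMod (p := ℓ))) := by
  have hres := stage_residual_eq ρ₁ ρ₂ E hE hr
  intro σ τ
  -- the identity over `ℤ_ℓ`
  have hD : E (σ * τ) * (((ρ₂ (σ * τ))⁻¹ : GL (Fin n) ℤ_[ℓ]) : Matrix (Fin n) (Fin n) ℤ_[ℓ]) =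
      E σ * (((ρ₂ σ)⁻¹ : GL (Fin n) ℤ_[ℓ]) : Matrix (Fin n) (Fin n) ℤ_[ℓ]) +
      ((ρ₂ σ : GL (Fin n) ℤ_[ℓ]) : Matrix (Fin n) (Fin n) ℤ_[ℓ]) *
        (E τ * (((ρ₂ τ)⁻¹ : GL (Fin n) ℤ_[ℓ]) : Matrix (Fin n) (Fin n) ℤ_[ℓ])) *
        (((ρ₂ σ)⁻¹ : GL (Fin n) ℤ_[ℓ]) : Matrix (Fin n) (Fin n) ℤ_[ℓ]) +
      ((ℓ : ℤ_[ℓ]) ^ r) • (E σ * (E τ * (((ρ₂ τ)⁻¹ : GL (Fin n) ℤ_[ℓ]) : Matrix (Fin n) (Fin n) ℤ_[ℓ])) *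
        (((ρ₂ σ)⁻¹ : GL (Fin n) ℤ_[ℓ]) : Matrix (Fin n) (Fin n) ℤ_[ℓ])) := by
    rw [stage_E_mul ρ₁ ρ₂ E hE, map_mul, _root_.mul_inv_rev, Units.val_mul, stage_key ρ₁ ρ₂ E hE τ]
    simp only [Matrix.add_mul, Matrix.mul_add, Matrix.mul_assoc, Matrix.mul_smul, Matrix.smul_mul,
      Units.mul_inv_cancel_left]
    abel
  have hresσ : (((ρ₂ σ : GL (Fin n) ℤ_[ℓ]) : Matrix (Fin n) (Fin n) ℤ_[ℓ])).map (PadicInt.toZMod (p := ℓ)) =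
      ((residual ρ₁ σ : GL (Fin n) (ZMod ℓ)) : Matrix (Fin n) (Fin n) (ZMod ℓ)) := by
    rw [← hres]; rfl
  have hresσ' : (((ρ₂ σ)⁻¹ : GL (Fin n) ℤ_[ℓ]) : Matrix (Fin n) (Fin n) ℤ_[ℓ]).map (PadicInt.toZMod (p := ℓ)) =
      (((residual ρ₁ σ)⁻¹ : GL (Fin n) (ZMod ℓ)) : Matrix (Fin n) (Fin n) (ZMod ℓ)) := by
    rw [← hres]; rfl
  simp only
  rw [hD, Matrix.map_add _ (map_add _), Matrix.map_add _ (map_add _), map_toZMod_smul_pow hr, add_zero]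
  simp only [Matrix.map_mul, hresσ, hresσ', Matrix.mul_assoc]

variable [TopologicalSpace Γ]

/-- The deviation cocycle of two CONTINUOUS representations is locally constant: `μ(σ)` only depends
on `ρ₁(σ), ρ₂(σ) mod ℓ^{r+1}`. [cite: BrumerEtAl2019, §2.3 p. 1153] -/
theorem stage_isLocallyConstant
    (h₁ : Continuous fun σ => ((ρ₁ σ : GL (Fin n) ℤ_[ℓ]) : Matrix (Fin n) (Fin n) ℤ_[ℓ]))
    (h₂ : Continuous fun σ => ((ρ₂ σ : GL (Fin n) ℤ_[ℓ]) : Matrix (Fin n) (Fin n) ℤ_[ℓ]))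
    (h₂' : Continuous fun σ => (((ρ₂ σ)⁻¹ : GL (Fin n) ℤ_[ℓ]) : Matrix (Fin n) (Fin n) ℤ_[ℓ])) :
    IsLocallyConstant
      (fun σ => (E σ * (((ρ₂ σ)⁻¹ : GL (Fin n) ℤ_[ℓ]) : Matrix (Fin n) (Fin n) ℤ_[ℓ])).map
        (PadicInt.toZMod (p := ℓ))) := by
  have hfac : (fun σ => (E σ * (((ρ₂ σ)⁻¹ : GL (Fin n) ℤ_[ℓ]) : Matrix (Fin n) (Fin n) ℤ_[ℓ])).map
      (PadicInt.toZMod (p := ℓ))) = fun σ => (E σ).map (PadicInt.toZMod (p := ℓ)) *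
        (((ρ₂ σ)⁻¹ : GL (Fin n) ℤ_[ℓ]) : Matrix (Fin n) (Fin n) ℤ_[ℓ]).map (PadicInt.toZMod (p := ℓ)) := by
    funext σ
    rw [Matrix.map_mul]
  rw [hfac]
  refine IsLocallyConstant.mul ?_ ((IsLocallyConstant.iff_continuous _).2 (h₂'.matrix_map continuous_toZMod))
  rw [IsLocallyConstant.iff_eventually_eq]
  intro σ₀
  have hX : IsLocallyConstant fun σ => (((ρ₁ σ : GL (Fin n) ℤ_[ℓ]) : Matrix (Fin n) (Fin n) ℤ_[ℓ]) -
      ((ρ₂ σ : GL (Fin n) ℤ_[ℓ]) : Matrix (Fin n) (Fin n) ℤ_[ℓ])).map (PadicInt.toZModPow (p := ℓ) (r + 1)) :=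
    (IsLocallyConstant.iff_continuous _).2 ((h₁.sub h₂).matrix_map (OneUnits.continuous_toZModPow ℓ (r + 1)))
  filter_upwards [hX.eventually_eq σ₀] with σ hσ
  obtain ⟨W, hW⟩ := exists_sub_eq_smul_of_map_toZModPow_eq (r + 1) _ _ hσ
  rw [hE, hE, ← smul_sub, pow_succ, mul_smul] at hW
  have hEE := smul_pow_cancel hW
  rw [sub_eq_iff_eq_add] at hEE
  rw [hEE, Matrix.map_add _ (map_add _)]
  have h0 : ((ℓ : ℤ_[ℓ]) • W).map (PadicInt.toZMod (p := ℓ)) = 0 := by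
    have := map_toZMod_smul_pow (le_refl 1) W
    rwa [pow_one] at this
  rw [h0, zero_add]

omit [TopologicalSpace Γ] in
/-- **[BPPTVY, Prop. 2.3.14(c), (2.3.15)]**: `utr φ_μ(σ) = tr(μ(σ)ρ̄(σ)) ≡ (tr ρ₁(σ) - tr ρ₂(σ))/ℓ^r (mod ℓ)`;
in particular an element at which the traces of `ρ₁, ρ₂` agree is not obstructing for `μ`.
[cite: BrumerEtAl2019, Prop. 2.3.14(c) and (2.3.15) pp. 1154–1155] -/
theorem stage_trace (hr : 1 ≤ r) (σ : Γ)
    (htr : ((ρ₁ σ : GL (Fin n) ℤ_[ℓ]) : Matrix (Fin n) (Fin n) ℤ_[ℓ]).trace =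
      ((ρ₂ σ : GL (Fin n) ℤ_[ℓ]) : Matrix (Fin n) (Fin n) ℤ_[ℓ]).trace) :
    Matrix.trace ((E σ * (((ρ₂ σ)⁻¹ : GL (Fin n) ℤ_[ℓ]) : Matrix (Fin n) (Fin n) ℤ_[ℓ])).map
        (PadicInt.toZMod (p := ℓ)) * ((residual ρ₁ σ : GL (Fin n) (ZMod ℓ)) : Matrix (Fin n) (Fin n) (ZMod ℓ))) = 0 := by
  have hres := stage_residual_eq ρ₁ ρ₂ E hE hr
  rw [← hres, residual_apply_coe, ← Matrix.map_mul, Matrix.mul_assoc, Units.inv_mul, Matrix.mul_one,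
    ← AddMonoidHom.map_trace (PadicInt.toZMod (p := ℓ))]
  have h := congrArg Matrix.trace (hE σ)
  rw [Matrix.trace_sub, Matrix.trace_smul, htr, sub_self, smul_eq_mul] at h
  have hE0 : (E σ).trace = 0 :=
    (mul_eq_zero.1 h.symm).resolve_left (pow_ne_zero r natCast_ell_ne_zero)
  rw [hE0, map_zero]

omit [TopologicalSpace Γ] in
/-- **[BPPTVY, Lemma 2.3.6(b) (⇐)], made explicit**: if the deviation cocycle is the coboundary of
`a = A mod ℓ`, then `P = 1 + ℓ^r A` conjugates `ρ₂` into `ρ₁` modulo `ℓ^{r+1}`: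
`ρ₁(σ) P - P ρ₂(σ) ≡ 0 (mod ℓ^{r+1})`. [cite: BrumerEtAl2019, Lemma 2.3.6(b) p. 1153] -/
theorem stage_conj (hr : 1 ≤ r) (a : Matrix (Fin n) (Fin n) (ZMod ℓ))
    (ha : ∀ σ, (E σ * (((ρ₂ σ)⁻¹ : GL (Fin n) ℤ_[ℓ]) : Matrix (Fin n) (Fin n) ℤ_[ℓ])).map
        (PadicInt.toZMod (p := ℓ)) =
      a - ((residual ρ₁ σ : GL (Fin n) (ZMod ℓ)) : Matrix (Fin n) (Fin n) (ZMod ℓ)) * a *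
        (((residual ρ₁ σ)⁻¹ : GL (Fin n) (ZMod ℓ)) : Matrix (Fin n) (Fin n) (ZMod ℓ)))
    (A : Matrix (Fin n) (Fin n) ℤ_[ℓ]) (hA : A.map (PadicInt.toZMod (p := ℓ)) = a) (σ : Γ) :
    ∃ N : Matrix (Fin n) (Fin n) ℤ_[ℓ],
      ((ρ₁ σ : GL (Fin n) ℤ_[ℓ]) : Matrix (Fin n) (Fin n) ℤ_[ℓ]) * (1 + ((ℓ : ℤ_[ℓ]) ^ r) • A) -
        (1 + ((ℓ : ℤ_[ℓ]) ^ r) • A) * ((ρ₂ σ : GL (Fin n) ℤ_[ℓ]) : Matrix (Fin n) (Fin n) ℤ_[ℓ]) =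
        ((ℓ : ℤ_[ℓ]) ^ (r + 1)) • N := by
  have hres := stage_residual_eq ρ₁ ρ₂ E hE hr
  -- `E + ρ₂ A - A ρ₂ ≡ 0 (mod ℓ)`
  obtain ⟨W, hW⟩ : ∃ W : Matrix (Fin n) (Fin n) ℤ_[ℓ],
      E σ + ((ρ₂ σ : GL (Fin n) ℤ_[ℓ]) : Matrix (Fin n) (Fin n) ℤ_[ℓ]) * A -
        A * ((ρ₂ σ : GL (Fin n) ℤ_[ℓ]) : Matrix (Fin n) (Fin n) ℤ_[ℓ]) = (ℓ : ℤ_[ℓ]) • W := by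
    apply exists_eq_smul_of_map_toZMod_eq_zero
    have hEmap : (E σ).map (PadicInt.toZMod (p := ℓ)) =
        (a - ((residual ρ₁ σ : GL (Fin n) (ZMod ℓ)) : Matrix (Fin n) (Fin n) (ZMod ℓ)) * a *
          (((residual ρ₁ σ)⁻¹ : GL (Fin n) (ZMod ℓ)) : Matrix (Fin n) (Fin n) (ZMod ℓ))) *
          ((residual ρ₁ σ : GL (Fin n) (ZMod ℓ)) : Matrix (Fin n) (Fin n) (ZMod ℓ)) := by
      rw [← ha, ← hres, residual_apply_coe, ← Matrix.map_mul, Matrix.mul_assoc, Units.inv_mul,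
        Matrix.mul_one]
    rw [Matrix.map_sub _ (map_sub _), Matrix.map_add _ (map_add _), Matrix.map_mul, Matrix.map_mul, hA,
      hEmap, ← residual_apply_coe, hres, Matrix.sub_mul, Matrix.mul_assoc, Matrix.mul_assoc,
      Units.inv_mul, Matrix.mul_one]
    abel
  refine ⟨W + ((ℓ : ℤ_[ℓ]) ^ (r - 1)) • (E σ * A), ?_⟩
  have hEσ : E σ = (ℓ : ℤ_[ℓ]) • W - ((ρ₂ σ : GL (Fin n) ℤ_[ℓ]) : Matrix (Fin n) (Fin n) ℤ_[ℓ]) * A +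
      A * ((ρ₂ σ : GL (Fin n) ℤ_[ℓ]) : Matrix (Fin n) (Fin n) ℤ_[ℓ]) := by
    rw [← hW]; abel
  rw [stage_key ρ₁ ρ₂ E hE σ, hEσ]
  obtain ⟨s, rfl⟩ : ∃ s, r = s + 1 := ⟨r - 1, by omega⟩
  rw [Nat.add_sub_cancel]
  simp only [Matrix.add_mul, Matrix.mul_add, Matrix.sub_mul, Matrix.smul_mul,
    Matrix.mul_smul, Matrix.one_mul, Matrix.mul_one, smul_add, smul_sub, smul_smul, Matrix.mul_assoc]
  module

/-- **One step of the correctness proof of [BPPTVY, Algorithm 2.4.1]** (pp. 1156–1157), for a class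
`V` of allowed cocycle values: if `ρ₁ ≡ ρ₂ (mod ℓ^r)` with deviation `E`, the deviation cocycle
`μ` takes values in `V`, every obstructing locally constant `V`-valued cocycle unramified at `I` is
detected by `T`, and the traces agree on `T`, then `μ` is a coboundary (else, by Cor. 2.3.19, `μ`
would be obstructing, detected at some `σ ∈ T`, contradicting (2.3.15)). [cite: BrumerEtAl2019, Algorithm 2.4.1, proof of correctness pp. 1156–1157] -/
theorem stage_coboundary (hr : 1 ≤ r)
    (h₁ : Continuous fun σ => ((ρ₁ σ : GL (Fin n) ℤ_[ℓ]) : Matrix (Fin n) (Fin n) ℤ_[ℓ]))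
    (h₂ : Continuous fun σ => ((ρ₂ σ : GL (Fin n) ℤ_[ℓ]) : Matrix (Fin n) (Fin n) ℤ_[ℓ]))
    (h₂' : Continuous fun σ => (((ρ₂ σ)⁻¹ : GL (Fin n) ℤ_[ℓ]) : Matrix (Fin n) (Fin n) ℤ_[ℓ]))
    (I T : Set Γ) (hirr : IsAbsIrreducible (residual ρ₁)) (hI : ∀ σ ∈ I, ρ₁ σ = 1 ∧ ρ₂ σ = 1)
    (V : Set (Matrix (Fin n) (Fin n) (ZMod ℓ)))
    (complete : ∀ μ : Γ → Matrix (Fin n) (Fin n) (ZMod ℓ), IsLocallyConstant μ → (∀ σ ∈ I, μ σ = 0) →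
      ValuedIn V μ → IsDeviationCocycle (residual ρ₁) μ → IsObstructing (residual ρ₁) μ →
      ∃ σ ∈ T, IsObstructingElt (residual ρ₁) μ σ)
    (traces : ∀ σ ∈ T, ((ρ₁ σ : GL (Fin n) ℤ_[ℓ]) : Matrix (Fin n) (Fin n) ℤ_[ℓ]).trace =
      ((ρ₂ σ : GL (Fin n) ℤ_[ℓ]) : Matrix (Fin n) (Fin n) ℤ_[ℓ]).trace)
    (hV : ∀ σ, (E σ * (((ρ₂ σ)⁻¹ : GL (Fin n) ℤ_[ℓ]) : Matrix (Fin n) (Fin n) ℤ_[ℓ])).map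
        (PadicInt.toZMod (p := ℓ)) ∈ V) :
    ∃ a : Matrix (Fin n) (Fin n) (ZMod ℓ), ∀ σ,
      (E σ * (((ρ₂ σ)⁻¹ : GL (Fin n) ℤ_[ℓ]) : Matrix (Fin n) (Fin n) ℤ_[ℓ])).map (PadicInt.toZMod (p := ℓ)) =
      a - ((residual ρ₁ σ : GL (Fin n) (ZMod ℓ)) : Matrix (Fin n) (Fin n) (ZMod ℓ)) * a *
        (((residual ρ₁ σ)⁻¹ : GL (Fin n) (ZMod ℓ)) : Matrix (Fin n) (Fin n) (ZMod ℓ)) := by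
  have hcoc := stage_cocycle ρ₁ ρ₂ E hE hr
  have hlc := stage_isLocallyConstant ρ₁ ρ₂ E hE h₁ h₂ h₂'
  have hμI : ∀ σ ∈ I, (E σ * (((ρ₂ σ)⁻¹ : GL (Fin n) ℤ_[ℓ]) : Matrix (Fin n) (Fin n) ℤ_[ℓ])).map
      (PadicInt.toZMod (p := ℓ)) = 0 := by
    intro σ hσ
    have h0 : ((ℓ : ℤ_[ℓ]) ^ r) • E σ = ((ℓ : ℤ_[ℓ]) ^ r) • (0 : Matrix (Fin n) (Fin n) ℤ_[ℓ]) := by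
      rw [← hE σ, (hI σ hσ).1, (hI σ hσ).2, sub_self, smul_zero]
    rw [smul_pow_cancel h0, Matrix.zero_mul, Matrix.map_zero _ (map_zero _)]
  by_contra hnot
  have hnot' : ¬ IsDeviationCoboundary (residual ρ₁)
      (fun σ => (E σ * (((ρ₂ σ)⁻¹ : GL (Fin n) ℤ_[ℓ]) : Matrix (Fin n) (Fin n) ℤ_[ℓ])).map
        (PadicInt.toZMod (p := ℓ))) := fun ⟨a, ha⟩ => hnot ⟨a, ha⟩
  obtain ⟨σ, hσT, hσ⟩ := complete _ hlc hμI hV hcoc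
    (isObstructing_of_not_isDeviationCoboundary _ hirr hcoc hnot')
  exact hσ (stage_trace ρ₁ ρ₂ E hE hr σ (traces σ hσT))

end Stage

/-! ### The criterion for `G = GL_n` -/

section GeneralLinear

/-- **[BPPTVY, Thm. 2.1.5 / Algorithm 2.4.1] holds for `G = GL_n`** (discharge of the named fact
`traceEq_of_faltingsSerre`).  Proof = the correctness proof of Algorithm 2.4.1 (pp. 1156–1157) run
as an induction on `r`: from `ρ₁ P ≡ P ρ₂ (mod ℓ^r)` either the deviation cocycle of
`(ρ₁, Pρ₂P⁻¹)` is a coboundary and `P` improves to `(1 + ℓ^r A)P` (Lemma 2.3.6), or it is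
obstructing (Cor. 2.3.19) and detected on `T` — impossible by (2.3.15) and the hypothesis `traces`.
Hence `tr ρ₁ ≡ tr ρ₂ (mod ℓ^r)` for every `r`, i.e. `tr ρ₁ = tr ρ₂`. [cite: BrumerEtAl2019, Thm. 2.1.5 p. 1150; Algorithm 2.4.1 and its proof of correctness pp. 1156–1157] -/
theorem traceEq_of_faltingsSerre_holds : traceEq_of_faltingsSerre := by
  intro ℓ _ Γ _ _ _ n ρ₁ ρ₂ h₁ h₂ I T h0 hirr hI complete traces σ₀
  have hc₁ : Continuous fun σ => ((ρ₁ σ : GL (Fin n) ℤ_[ℓ]) : Matrix (Fin n) (Fin n) ℤ_[ℓ]) :=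
    Units.continuous_val.comp h₁
  have hc₂ : Continuous fun σ => ((ρ₂ σ : GL (Fin n) ℤ_[ℓ]) : Matrix (Fin n) (Fin n) ℤ_[ℓ]) :=
    Units.continuous_val.comp h₂
  have hc₂' : Continuous fun σ => (((ρ₂ σ)⁻¹ : GL (Fin n) ℤ_[ℓ]) : Matrix (Fin n) (Fin n) ℤ_[ℓ]) :=
    Units.continuous_coe_inv.comp h₂
  -- the induction: `ρ₁ P ≡ P ρ₂ (mod ℓ^r)` for every `r ≥ 1`
  have good : ∀ r : ℕ, 1 ≤ r → ∃ P : GL (Fin n) ℤ_[ℓ], ∃ N : Γ → Matrix (Fin n) (Fin n) ℤ_[ℓ], ∀ σ,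
      ((ρ₁ σ : GL (Fin n) ℤ_[ℓ]) : Matrix (Fin n) (Fin n) ℤ_[ℓ]) * P -
        P * ((ρ₂ σ : GL (Fin n) ℤ_[ℓ]) : Matrix (Fin n) (Fin n) ℤ_[ℓ]) = ((ℓ : ℤ_[ℓ]) ^ r) • N σ := by
    intro r hr
    induction r, hr using Nat.le_induction with
    | base =>
      have hN : ∀ σ, ∃ N : Matrix (Fin n) (Fin n) ℤ_[ℓ],
          ((ρ₁ σ : GL (Fin n) ℤ_[ℓ]) : Matrix (Fin n) (Fin n) ℤ_[ℓ]) -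
            ((ρ₂ σ : GL (Fin n) ℤ_[ℓ]) : Matrix (Fin n) (Fin n) ℤ_[ℓ]) = (ℓ : ℤ_[ℓ]) • N := by
        intro σ
        apply exists_eq_smul_of_map_toZMod_eq_zero
        rw [Matrix.map_sub _ (map_sub _), ← residual_apply_coe, ← residual_apply_coe, h0, sub_self]
      choose N hN using hN
      refine ⟨1, N, fun σ => ?_⟩
      rw [Units.val_one, Matrix.mul_one, Matrix.one_mul, pow_one, hN]
    | succ r hr ih =>
      obtain ⟨P, N, hN⟩ := ih
      -- the conjugate `ρ₂' = P ρ₂ P⁻¹`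
      set ρ₂' : Γ →* GL (Fin n) ℤ_[ℓ] := (MulAut.conj P).toMonoidHom.comp ρ₂ with hρ₂'def
      have hρ₂' : ∀ σ, ρ₂' σ = P * ρ₂ σ * P⁻¹ := fun σ => rfl
      have hE : ∀ σ, ((ρ₁ σ : GL (Fin n) ℤ_[ℓ]) : Matrix (Fin n) (Fin n) ℤ_[ℓ]) -
          ((ρ₂' σ : GL (Fin n) ℤ_[ℓ]) : Matrix (Fin n) (Fin n) ℤ_[ℓ]) =
          ((ℓ : ℤ_[ℓ]) ^ r) • (N σ * ((P⁻¹ : GL (Fin n) ℤ_[ℓ]) : Matrix (Fin n) (Fin n) ℤ_[ℓ])) := by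
        intro σ
        rw [← smul_mul_assoc, ← hN σ, hρ₂', Units.val_mul, Units.val_mul, Matrix.sub_mul,
          Units.mul_inv_cancel_right]
      have hc₂'c : Continuous fun σ => ((ρ₂' σ : GL (Fin n) ℤ_[ℓ]) : Matrix (Fin n) (Fin n) ℤ_[ℓ]) := by
        simp only [hρ₂', Units.val_mul]
        exact (continuous_const.mul hc₂).mul continuous_const
      have hc₂'i : Continuous fun σ => (((ρ₂' σ)⁻¹ : GL (Fin n) ℤ_[ℓ]) : Matrix (Fin n) (Fin n) ℤ_[ℓ]) := by
        have hinv : ∀ σ, (ρ₂' σ)⁻¹ = P * (ρ₂ σ)⁻¹ * P⁻¹ := fun σ => by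
          rw [hρ₂', _root_.mul_inv_rev, _root_.mul_inv_rev, inv_inv, mul_assoc]
        simp only [hinv, Units.val_mul]
        exact (continuous_const.mul hc₂').mul continuous_const
      have hI' : ∀ σ ∈ I, ρ₁ σ = 1 ∧ ρ₂' σ = 1 := fun σ hσ =>
        ⟨(hI σ hσ).1, by rw [hρ₂', (hI σ hσ).2, mul_one, mul_inv_cancel]⟩
      have htr' : ∀ σ ∈ T, ((ρ₁ σ : GL (Fin n) ℤ_[ℓ]) : Matrix (Fin n) (Fin n) ℤ_[ℓ]).trace =
          ((ρ₂' σ : GL (Fin n) ℤ_[ℓ]) : Matrix (Fin n) (Fin n) ℤ_[ℓ]).trace := fun σ hσ => by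
        rw [traces σ hσ, hρ₂', Units.val_mul, Units.val_mul, Matrix.trace_units_conj]
      -- the step
      obtain ⟨a, ha⟩ := stage_coboundary ρ₁ ρ₂' _ hE hr hc₁ hc₂'c hc₂'i I T hirr hI' Set.univ
        (fun μ hlc hμI _ hc ho => complete μ hlc hμI hc ho) htr' (fun σ => Set.mem_univ _)
      obtain ⟨A, hA⟩ := exists_map_toZMod_eq a
      choose N' hN' using stage_conj ρ₁ ρ₂' _ hE hr a ha A hA
      obtain ⟨Q, hQ⟩ := isUnit_one_add_smul_pow hr A
      refine ⟨Q * P, fun σ => N' σ * (P : Matrix (Fin n) (Fin n) ℤ_[ℓ]), fun σ => ?_⟩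
      have hfac : ((ρ₁ σ : GL (Fin n) ℤ_[ℓ]) : Matrix (Fin n) (Fin n) ℤ_[ℓ]) * ((Q * P : GL (Fin n) ℤ_[ℓ]) :
            Matrix (Fin n) (Fin n) ℤ_[ℓ]) - ((Q * P : GL (Fin n) ℤ_[ℓ]) : Matrix (Fin n) (Fin n) ℤ_[ℓ]) *
            ((ρ₂ σ : GL (Fin n) ℤ_[ℓ]) : Matrix (Fin n) (Fin n) ℤ_[ℓ]) =
          (((ρ₁ σ : GL (Fin n) ℤ_[ℓ]) : Matrix (Fin n) (Fin n) ℤ_[ℓ]) * (1 + ((ℓ : ℤ_[ℓ]) ^ r) • A) -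
            (1 + ((ℓ : ℤ_[ℓ]) ^ r) • A) * ((ρ₂' σ : GL (Fin n) ℤ_[ℓ]) : Matrix (Fin n) (Fin n) ℤ_[ℓ])) *
            (P : Matrix (Fin n) (Fin n) ℤ_[ℓ]) := by
        simp only [hρ₂', Units.val_mul, hQ, Matrix.sub_mul, Matrix.mul_assoc, Units.inv_mul, Matrix.mul_one]
      rw [hfac, hN' σ, smul_mul_assoc]
  -- conclusion: `tr ρ₁(σ₀) - tr ρ₂(σ₀)` is divisible by every power of `ℓ`
  have hmem : ∀ m : ℕ, ((ρ₁ σ₀ : GL (Fin n) ℤ_[ℓ]) : Matrix (Fin n) (Fin n) ℤ_[ℓ]).trace -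
      ((ρ₂ σ₀ : GL (Fin n) ℤ_[ℓ]) : Matrix (Fin n) (Fin n) ℤ_[ℓ]).trace ∈ Ideal.span {(ℓ : ℤ_[ℓ]) ^ m} := by
    intro m
    rcases Nat.eq_zero_or_pos m with rfl | hm
    · rw [pow_zero, Ideal.span_singleton_one]; exact Submodule.mem_top
    obtain ⟨P, N, hN⟩ := good m hm
    have hdiff : ((ρ₁ σ₀ : GL (Fin n) ℤ_[ℓ]) : Matrix (Fin n) (Fin n) ℤ_[ℓ]) -
        (P : Matrix (Fin n) (Fin n) ℤ_[ℓ]) * ((ρ₂ σ₀ : GL (Fin n) ℤ_[ℓ]) : Matrix (Fin n) (Fin n) ℤ_[ℓ]) *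
          ((P⁻¹ : GL (Fin n) ℤ_[ℓ]) : Matrix (Fin n) (Fin n) ℤ_[ℓ]) =
        ((ℓ : ℤ_[ℓ]) ^ m) • (N σ₀ * ((P⁻¹ : GL (Fin n) ℤ_[ℓ]) : Matrix (Fin n) (Fin n) ℤ_[ℓ])) := by
      rw [← smul_mul_assoc, ← hN σ₀, Matrix.sub_mul, Units.mul_inv_cancel_right]
    rw [← Matrix.trace_units_conj P ((ρ₂ σ₀ : GL (Fin n) ℤ_[ℓ]) : Matrix (Fin n) (Fin n) ℤ_[ℓ]),
      ← Matrix.trace_sub, hdiff, Matrix.trace_smul, smul_eq_mul]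
    exact Ideal.mul_mem_right _ _ (Ideal.mem_span_singleton_self _)
  exact sub_eq_zero.1 (eq_zero_of_forall_mem_span_pow _ hmem)

end GeneralLinear

/-! ## The symplectic refinement

### Alternating matrices (`Xᵀ = -X` with zero diagonal, equivalently `X = U - Uᵀ`) -/

section Alternating

variable {R : Type*} [CommRing R] {n : ℕ}

/-- A skew-symmetric matrix with zero diagonal is of the form `U - Uᵀ` (`U` = its strictly upper
triangular part). [folklore] -/
theorem exists_eq_sub_transpose (X : Matrix (Fin n) (Fin n) R) (hXt : Xᵀ = -X) (hXd : ∀ i, X i i = 0) :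
    ∃ U : Matrix (Fin n) (Fin n) R, X = U - Uᵀ := by
  refine ⟨Matrix.of fun i j => if i < j then X i j else 0, ?_⟩
  ext i j
  have hji : X j i = -X i j := by
    have h := congrFun (congrFun hXt i) j
    rwa [Matrix.transpose_apply, Matrix.neg_apply] at h
  rcases lt_trichotomy i j with h | rfl | h
  · simp [Matrix.of_apply, h, h.not_gt]
  · simp [hXd]
  · simp [Matrix.of_apply, h, h.not_gt, hji]

/-- `U - Uᵀ` is skew-symmetric with zero diagonal. [folklore] -/
theorem transpose_sub_transpose_eq_neg (U : Matrix (Fin n) (Fin n) R) :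
    (U - Uᵀ)ᵀ = -(U - Uᵀ) ∧ ∀ i, (U - Uᵀ) i i = 0 := by
  refine ⟨by rw [Matrix.transpose_sub, Matrix.transpose_transpose, neg_sub], fun i => ?_⟩
  rw [Matrix.sub_apply, Matrix.transpose_apply, sub_self]

/-- Congruence preserves the shape `U - Uᵀ`: `Pᵀ (U - Uᵀ) Q`-type identity with `Q = P`. [folklore] -/
theorem transpose_mul_sub_transpose_mul (P U : Matrix (Fin n) (Fin n) R) :
    Pᵀ * (U - Uᵀ) * P = Pᵀ * U * P - (Pᵀ * U * P)ᵀ := by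
  rw [Matrix.transpose_mul, Matrix.transpose_mul, Matrix.transpose_transpose, Matrix.mul_sub,
    Matrix.sub_mul, Matrix.mul_assoc, Matrix.mul_assoc]

/-- `Aᵀ X + X A` has the shape `W - Wᵀ` when `X = U - Uᵀ` does. [folklore] -/
theorem transpose_mul_add_mul_sub_transpose (A U : Matrix (Fin n) (Fin n) R) :
    Aᵀ * (U - Uᵀ) + (U - Uᵀ) * A = (Aᵀ * U + U * A) - (Aᵀ * U + U * A)ᵀ := by
  rw [Matrix.transpose_add, Matrix.transpose_mul, Matrix.transpose_mul, Matrix.transpose_transpose,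
    Matrix.mul_sub, Matrix.sub_mul]
  abel

/-- **Solvability of `Nᵀ J + J N = G` for alternating `G`** when `J` is skew-symmetric and has a
right inverse `K`: `N = K U` for `G = U - Uᵀ` (then `J N = U` and `Nᵀ J = (Jᵀ N)ᵀ = -Uᵀ`). [folklore] -/
theorem exists_transpose_mul_add_mul_eq (J K U : Matrix (Fin n) (Fin n) R) (hJK : J * K = 1)
    (hJt : Jᵀ = -J) : ∃ N : Matrix (Fin n) (Fin n) R, Nᵀ * J + J * N = U - Uᵀ := by
  refine ⟨K * U, ?_⟩
  have hJN : J * (K * U) = U := by rw [← Matrix.mul_assoc, hJK, Matrix.one_mul]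
  have hNJ : (K * U)ᵀ * J = -Uᵀ := by
    have h : (Jᵀ * (K * U))ᵀ = (K * U)ᵀ * J := by
      rw [Matrix.transpose_mul, Matrix.transpose_transpose]
    rw [← h, hJt, Matrix.neg_mul, hJN, Matrix.transpose_neg]
  rw [hJN, hNJ, neg_add_eq_sub]

end Alternating

/-! ### Schur: a coboundary witness of an `𝔰𝔭(J̄)`-valued cocycle lies in `𝔤𝔰𝔭(J̄)` -/

section GSpLie

universe u

variable {k : Type u} [Field k] {Γ : Type*} [Group Γ] {n : ℕ}

/-- If `ρ̄` consists of similitudes of an invertible `J̄` (`ρ̄(σ)ᵀ J̄ ρ̄(σ) = ν̄(σ) J̄`), the `ρ̄(σ)`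
span `M_n(k)`, and the coboundary `σ ↦ a - ρ̄(σ) a ρ̄(σ)⁻¹` of `a` takes values in `𝔰𝔭(J̄)`, then
`a ∈ 𝔤𝔰𝔭(J̄)`: `aᵀ J̄ + J̄ a = c J̄` for a scalar `c`.  (With `N = aᵀJ̄ + J̄a` one gets
`ρ̄(σ)ᵀ N ρ̄(σ) = ν̄(σ) N`, so `J̄⁻¹N` commutes with every `ρ̄(σ)` and is scalar by Schur's lemma.)
[folklore] -/
theorem exists_transpose_mul_add_mul_eq_smul (ρbar : Γ →* GL (Fin n) k)
    (hspan : Submodule.span k (Set.range fun g =>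
      ((ρbar g : GL (Fin n) k) : Matrix (Fin n) (Fin n) k)) = ⊤)
    (Jb : Matrix (Fin n) (Fin n) k) (hJb : IsUnit Jb.det) (νb : Γ → k)
    (hν : ∀ σ, ((ρbar σ : GL (Fin n) k) : Matrix (Fin n) (Fin n) k)ᵀ * Jb *
      ((ρbar σ : GL (Fin n) k) : Matrix (Fin n) (Fin n) k) = νb σ • Jb)
    (a : Matrix (Fin n) (Fin n) k)
    (ha : ∀ σ, (a - ((ρbar σ : GL (Fin n) k) : Matrix (Fin n) (Fin n) k) * a *
        (((ρbar σ)⁻¹ : GL (Fin n) k) : Matrix (Fin n) (Fin n) k))ᵀ * Jb +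
      Jb * (a - ((ρbar σ : GL (Fin n) k) : Matrix (Fin n) (Fin n) k) * a *
        (((ρbar σ)⁻¹ : GL (Fin n) k) : Matrix (Fin n) (Fin n) k)) = 0) :
    ∃ c : k, aᵀ * Jb + Jb * a = c • Jb := by
  set Nb := aᵀ * Jb + Jb * a with hNb
  -- transposed inverses
  have hginvT : ∀ σ, (((ρbar σ)⁻¹ : GL (Fin n) k) : Matrix (Fin n) (Fin n) k)ᵀ *
      ((ρbar σ : GL (Fin n) k) : Matrix (Fin n) (Fin n) k)ᵀ = 1 := fun σ => by
    rw [← Matrix.transpose_mul, Units.mul_inv, Matrix.transpose_one]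
  have hgTinv : ∀ σ, ((ρbar σ : GL (Fin n) k) : Matrix (Fin n) (Fin n) k)ᵀ *
      (((ρbar σ)⁻¹ : GL (Fin n) k) : Matrix (Fin n) (Fin n) k)ᵀ = 1 := fun σ => by
    rw [← Matrix.transpose_mul, Units.inv_mul, Matrix.transpose_one]
  -- `gᵀ N g = ν N`
  have h1 : ∀ σ, ((ρbar σ : GL (Fin n) k) : Matrix (Fin n) (Fin n) k)ᵀ * Nb *
      ((ρbar σ : GL (Fin n) k) : Matrix (Fin n) (Fin n) k) = νb σ • Nb := by
    intro σ
    have hexp := ha σ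
    rw [Matrix.transpose_sub, Matrix.transpose_mul, Matrix.transpose_mul, Matrix.sub_mul,
      Matrix.mul_sub] at hexp
    have hN : Nb = (((ρbar σ)⁻¹ : GL (Fin n) k) : Matrix (Fin n) (Fin n) k)ᵀ * (aᵀ *
        ((ρbar σ : GL (Fin n) k) : Matrix (Fin n) (Fin n) k)ᵀ) * Jb +
        Jb * (((ρbar σ : GL (Fin n) k) : Matrix (Fin n) (Fin n) k) * a *
          (((ρbar σ)⁻¹ : GL (Fin n) k) : Matrix (Fin n) (Fin n) k)) := by
      rw [hNb, ← sub_eq_zero, ← hexp]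
      abel
    calc ((ρbar σ : GL (Fin n) k) : Matrix (Fin n) (Fin n) k)ᵀ * Nb *
          ((ρbar σ : GL (Fin n) k) : Matrix (Fin n) (Fin n) k)
        = ((ρbar σ : GL (Fin n) k) : Matrix (Fin n) (Fin n) k)ᵀ *
            (((ρbar σ)⁻¹ : GL (Fin n) k) : Matrix (Fin n) (Fin n) k)ᵀ *
            (aᵀ * (((ρbar σ : GL (Fin n) k) : Matrix (Fin n) (Fin n) k)ᵀ * Jb *
              ((ρbar σ : GL (Fin n) k) : Matrix (Fin n) (Fin n) k))) +
          (((ρbar σ : GL (Fin n) k) : Matrix (Fin n) (Fin n) k)ᵀ * Jb *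
              ((ρbar σ : GL (Fin n) k) : Matrix (Fin n) (Fin n) k)) * a *
            ((((ρbar σ)⁻¹ : GL (Fin n) k) : Matrix (Fin n) (Fin n) k) *
              ((ρbar σ : GL (Fin n) k) : Matrix (Fin n) (Fin n) k)) := by
          rw [hN]; simp only [Matrix.mul_add, Matrix.add_mul, Matrix.mul_assoc]
      _ = νb σ • Nb := by
          rw [hgTinv, Matrix.one_mul, hν, Units.inv_mul, Matrix.mul_one, Matrix.mul_smul, Matrix.smul_mul,
            ← smul_add, hNb]
  -- `X = J̄⁻¹ N` commutes with every `ρ̄(σ)`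
  have hJinv : Jb * Jb⁻¹ = 1 := Matrix.mul_nonsing_inv Jb hJb
  have hJinv' : Jb⁻¹ * Jb = 1 := Matrix.nonsing_inv_mul Jb hJb
  have hcomm : ∀ σ, ((ρbar σ : GL (Fin n) k) : Matrix (Fin n) (Fin n) k) * (Jb⁻¹ * Nb) =
      Jb⁻¹ * Nb * ((ρbar σ : GL (Fin n) k) : Matrix (Fin n) (Fin n) k) := by
    intro σ
    -- `N g = ν g⁻ᵀ N`
    have hNg : Nb * ((ρbar σ : GL (Fin n) k) : Matrix (Fin n) (Fin n) k) =
        νb σ • ((((ρbar σ)⁻¹ : GL (Fin n) k) : Matrix (Fin n) (Fin n) k)ᵀ * Nb) := by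
      calc Nb * ((ρbar σ : GL (Fin n) k) : Matrix (Fin n) (Fin n) k)
          = (((ρbar σ)⁻¹ : GL (Fin n) k) : Matrix (Fin n) (Fin n) k)ᵀ *
              (((ρbar σ : GL (Fin n) k) : Matrix (Fin n) (Fin n) k)ᵀ * Nb *
                ((ρbar σ : GL (Fin n) k) : Matrix (Fin n) (Fin n) k)) := by
            rw [← Matrix.mul_assoc, ← Matrix.mul_assoc, hginvT, Matrix.one_mul]
        _ = νb σ • ((((ρbar σ)⁻¹ : GL (Fin n) k) : Matrix (Fin n) (Fin n) k)ᵀ * Nb) := by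
            rw [h1, Matrix.mul_smul]
    -- `J̄ g = ν g⁻ᵀ J̄`, hence `g J̄⁻¹ = ν J̄⁻¹ g⁻ᵀ`
    have hJg : Jb * ((ρbar σ : GL (Fin n) k) : Matrix (Fin n) (Fin n) k) =
        νb σ • ((((ρbar σ)⁻¹ : GL (Fin n) k) : Matrix (Fin n) (Fin n) k)ᵀ * Jb) := by
      calc Jb * ((ρbar σ : GL (Fin n) k) : Matrix (Fin n) (Fin n) k)
          = (((ρbar σ)⁻¹ : GL (Fin n) k) : Matrix (Fin n) (Fin n) k)ᵀ *
              (((ρbar σ : GL (Fin n) k) : Matrix (Fin n) (Fin n) k)ᵀ * Jb *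
                ((ρbar σ : GL (Fin n) k) : Matrix (Fin n) (Fin n) k)) := by
            rw [← Matrix.mul_assoc, ← Matrix.mul_assoc, hginvT, Matrix.one_mul]
        _ = νb σ • ((((ρbar σ)⁻¹ : GL (Fin n) k) : Matrix (Fin n) (Fin n) k)ᵀ * Jb) := by
            rw [hν, Matrix.mul_smul]
    have hgJ : ((ρbar σ : GL (Fin n) k) : Matrix (Fin n) (Fin n) k) * Jb⁻¹ =
        νb σ • (Jb⁻¹ * (((ρbar σ)⁻¹ : GL (Fin n) k) : Matrix (Fin n) (Fin n) k)ᵀ) := by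
      calc ((ρbar σ : GL (Fin n) k) : Matrix (Fin n) (Fin n) k) * Jb⁻¹
          = Jb⁻¹ * (Jb * ((ρbar σ : GL (Fin n) k) : Matrix (Fin n) (Fin n) k)) * Jb⁻¹ := by
            rw [← Matrix.mul_assoc, hJinv', Matrix.one_mul]
        _ = νb σ • (Jb⁻¹ * (((ρbar σ)⁻¹ : GL (Fin n) k) : Matrix (Fin n) (Fin n) k)ᵀ) := by
            rw [hJg, Matrix.mul_smul, Matrix.smul_mul, Matrix.mul_assoc, Matrix.mul_assoc, hJinv,
              Matrix.mul_one]
    rw [← Matrix.mul_assoc, hgJ, Matrix.smul_mul, Matrix.mul_assoc, Matrix.mul_assoc, ← Matrix.mul_smul,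
      ← hNg]
  obtain ⟨c, hc⟩ := exists_eq_smul_one_of_forall_comm ρbar hspan (Jb⁻¹ * Nb) hcomm
  refine ⟨c, ?_⟩
  calc Nb = Jb * (Jb⁻¹ * Nb) := by rw [← Matrix.mul_assoc, hJinv, Matrix.one_mul]
    _ = c • Jb := by rw [hc, Matrix.mul_smul, Matrix.mul_one]

end GSpLie

/-! ### The deviation cocycle of two similitudes with the same multiplier is `𝔰𝔭(J̄)`-valued -/

section SpValued

variable {ℓ : ℕ} [Fact ℓ.Prime] {Γ : Type*} [Group Γ] {n : ℕ}

/-- Reduction mod `ℓ` of a skew-symmetric matrix with zero diagonal divided by `ℓ^m`: if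
`ℓ^m F = U - Uᵀ` over `ℤ_ℓ` then `F mod ℓ = U' - U'ᵀ` for some `U'`. [folklore] -/
theorem exists_map_eq_sub_transpose {m : ℕ} (F U : Matrix (Fin n) (Fin n) ℤ_[ℓ])
    (h : ((ℓ : ℤ_[ℓ]) ^ m) • F = U - Uᵀ) :
    ∃ U' : Matrix (Fin n) (Fin n) (ZMod ℓ), F.map (PadicInt.toZMod (p := ℓ)) = U' - U'ᵀ := by
  have hsk := transpose_sub_transpose_eq_neg U
  rw [← h, Matrix.transpose_smul, ← smul_neg] at hsk
  have hFt : Fᵀ = -F := smul_pow_cancel hsk.1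
  have hFd : ∀ i, F i i = 0 := fun i => by
    have hi := hsk.2 i
    rw [Matrix.smul_apply, smul_eq_mul] at hi
    exact (mul_eq_zero.1 hi).resolve_left (pow_ne_zero m natCast_ell_ne_zero)
  refine exists_eq_sub_transpose _ ?_ fun i => ?_
  · rw [← Matrix.transpose_map, hFt]
    ext i j
    rw [Matrix.map_apply, Matrix.neg_apply, Matrix.neg_apply, Matrix.map_apply, map_neg]
  · rw [Matrix.map_apply, hFd, map_zero]

/-- **The symplectic refinement of Lemma 2.3.6(a)** ([BPPTVY, Lemma 2.3.20 / Remark 2.4.2] typed with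
equal multipliers, see `Criterion.lean`): if `ρ₁, ρ₂` are similitudes of `J` with the same multiplier
`ν`, `ρ₁ P ≡ P ρ₂ (mod ℓ^r)` with deviation `N` (`ρ₁P - Pρ₂ = ℓ^r N`) and `Pᵀ J P ≡ λ J (mod ℓ^{r+1})`,
then the deviation cocycle `μ(σ) = (N(σ) ρ₂(σ)⁻¹ P⁻¹ mod ℓ)` of `(ρ₁, Pρ₂P⁻¹)` takes values in
`𝔰𝔭(J̄)`.  (Compare `(ρ₁P)ᵀ J (ρ₁P) = ν PᵀJP` with the expansion of `(Pρ₂ + ℓ^r N)ᵀ J (Pρ₂ + ℓ^r N)`.)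
[cite: BrumerEtAl2019, Lemma 2.3.20 and Remark 2.4.2 p. 1156] -/
theorem sp_deviation_mem_spLie (ρ₁ ρ₂ : Γ →* GL (Fin n) ℤ_[ℓ]) (P : GL (Fin n) ℤ_[ℓ]) {r : ℕ} (hr : 1 ≤ r)
    (N : Γ → Matrix (Fin n) (Fin n) ℤ_[ℓ])
    (hN : ∀ σ, ((ρ₁ σ : GL (Fin n) ℤ_[ℓ]) : Matrix (Fin n) (Fin n) ℤ_[ℓ]) * P -
      P * ((ρ₂ σ : GL (Fin n) ℤ_[ℓ]) : Matrix (Fin n) (Fin n) ℤ_[ℓ]) = ((ℓ : ℤ_[ℓ]) ^ r) • N σ)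
    (J : Matrix (Fin n) (Fin n) ℤ_[ℓ]) (ν : Γ → ℤ_[ℓ])
    (hν₁ : ∀ σ, ((ρ₁ σ : GL (Fin n) ℤ_[ℓ]) : Matrix (Fin n) (Fin n) ℤ_[ℓ])ᵀ * J *
      ((ρ₁ σ : GL (Fin n) ℤ_[ℓ]) : Matrix (Fin n) (Fin n) ℤ_[ℓ]) = ν σ • J)
    (hν₂ : ∀ σ, ((ρ₂ σ : GL (Fin n) ℤ_[ℓ]) : Matrix (Fin n) (Fin n) ℤ_[ℓ])ᵀ * J *
      ((ρ₂ σ : GL (Fin n) ℤ_[ℓ]) : Matrix (Fin n) (Fin n) ℤ_[ℓ]) = ν σ • J)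
    (lam : ℤ_[ℓ]) (F : Matrix (Fin n) (Fin n) ℤ_[ℓ])
    (hPJ : (P : Matrix (Fin n) (Fin n) ℤ_[ℓ])ᵀ * J * P = lam • J + ((ℓ : ℤ_[ℓ]) ^ (r + 1)) • F) (σ : Γ) :
    (N σ * (((ρ₂ σ)⁻¹ : GL (Fin n) ℤ_[ℓ]) : Matrix (Fin n) (Fin n) ℤ_[ℓ]) *
      ((P⁻¹ : GL (Fin n) ℤ_[ℓ]) : Matrix (Fin n) (Fin n) ℤ_[ℓ])).map (PadicInt.toZMod (p := ℓ)) ∈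
      spLie (J.map (PadicInt.toZMod (p := ℓ))) := by
  obtain ⟨s, rfl⟩ : ∃ s, r = s + 1 := ⟨r - 1, by omega⟩
  -- `X = P ρ₂(σ)` and `ρ₁(σ) P = X + ℓ^r N(σ)`
  set X : Matrix (Fin n) (Fin n) ℤ_[ℓ] := (P : Matrix (Fin n) (Fin n) ℤ_[ℓ]) *
    ((ρ₂ σ : GL (Fin n) ℤ_[ℓ]) : Matrix (Fin n) (Fin n) ℤ_[ℓ]) with hX
  clear_value X
  have hρP : ((ρ₁ σ : GL (Fin n) ℤ_[ℓ]) : Matrix (Fin n) (Fin n) ℤ_[ℓ]) * P =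
      X + ((ℓ : ℤ_[ℓ]) ^ (s + 1)) • N σ := by
    rw [hX, ← hN σ]; abel
  -- the integral identity
  have e0 : (X + ((ℓ : ℤ_[ℓ]) ^ (s + 1)) • N σ)ᵀ * J * (X + ((ℓ : ℤ_[ℓ]) ^ (s + 1)) • N σ) =
      ν σ • (lam • J + ((ℓ : ℤ_[ℓ]) ^ (s + 1 + 1)) • F) := by
    rw [← hρP, ← hPJ, Matrix.transpose_mul]
    calc (P : Matrix (Fin n) (Fin n) ℤ_[ℓ])ᵀ * ((ρ₁ σ : GL (Fin n) ℤ_[ℓ]) : Matrix (Fin n) (Fin n) ℤ_[ℓ])ᵀ *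
          J * (((ρ₁ σ : GL (Fin n) ℤ_[ℓ]) : Matrix (Fin n) (Fin n) ℤ_[ℓ]) * P)
        = (P : Matrix (Fin n) (Fin n) ℤ_[ℓ])ᵀ * (((ρ₁ σ : GL (Fin n) ℤ_[ℓ]) : Matrix (Fin n) (Fin n) ℤ_[ℓ])ᵀ *
            J * ((ρ₁ σ : GL (Fin n) ℤ_[ℓ]) : Matrix (Fin n) (Fin n) ℤ_[ℓ])) * P := by
          simp only [Matrix.mul_assoc]
      _ = ν σ • ((P : Matrix (Fin n) (Fin n) ℤ_[ℓ])ᵀ * J * P) := by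
          rw [hν₁, Matrix.mul_smul, Matrix.smul_mul, Matrix.mul_assoc]
  have e2 : Xᵀ * J * X = lam • (ν σ • J) + ((ℓ : ℤ_[ℓ]) ^ (s + 1 + 1)) •
      (((ρ₂ σ : GL (Fin n) ℤ_[ℓ]) : Matrix (Fin n) (Fin n) ℤ_[ℓ])ᵀ * F *
        ((ρ₂ σ : GL (Fin n) ℤ_[ℓ]) : Matrix (Fin n) (Fin n) ℤ_[ℓ])) := by
    calc Xᵀ * J * X = ((ρ₂ σ : GL (Fin n) ℤ_[ℓ]) : Matrix (Fin n) (Fin n) ℤ_[ℓ])ᵀ *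
          ((P : Matrix (Fin n) (Fin n) ℤ_[ℓ])ᵀ * J * P) * ((ρ₂ σ : GL (Fin n) ℤ_[ℓ]) : Matrix (Fin n) (Fin n) ℤ_[ℓ]) := by
          rw [hX, Matrix.transpose_mul]; simp only [Matrix.mul_assoc]
      _ = _ := by
          rw [hPJ, Matrix.mul_add, Matrix.add_mul, Matrix.mul_smul, Matrix.smul_mul, hν₂, Matrix.mul_smul,
            Matrix.smul_mul]
  have hexp : ((ℓ : ℤ_[ℓ]) ^ (s + 1)) • ((N σ)ᵀ * J * X + Xᵀ * J * N σ) =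
      (X + ((ℓ : ℤ_[ℓ]) ^ (s + 1)) • N σ)ᵀ * J * (X + ((ℓ : ℤ_[ℓ]) ^ (s + 1)) • N σ) - Xᵀ * J * X -
        (((ℓ : ℤ_[ℓ]) ^ (s + 1)) * ((ℓ : ℤ_[ℓ]) ^ (s + 1))) • ((N σ)ᵀ * J * N σ) := by
    rw [Matrix.transpose_add, Matrix.transpose_smul]
    simp only [Matrix.add_mul, Matrix.mul_add, Matrix.smul_mul, Matrix.mul_smul, smul_add, smul_smul]
    module
  have hsum : ((ℓ : ℤ_[ℓ]) ^ (s + 1)) • ((N σ)ᵀ * J * X + Xᵀ * J * N σ) =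
      ((ℓ : ℤ_[ℓ]) ^ (s + 1)) • ((ℓ : ℤ_[ℓ]) • (ν σ • F -
        ((ρ₂ σ : GL (Fin n) ℤ_[ℓ]) : Matrix (Fin n) (Fin n) ℤ_[ℓ])ᵀ * F *
          ((ρ₂ σ : GL (Fin n) ℤ_[ℓ]) : Matrix (Fin n) (Fin n) ℤ_[ℓ]) -
        ((ℓ : ℤ_[ℓ]) ^ s) • ((N σ)ᵀ * J * N σ))) := by
    rw [hexp, e0, e2]
    module
  have hW := smul_pow_cancel hsum
  -- reduce mod `ℓ`
  have hWb : ((N σ).map (PadicInt.toZMod (p := ℓ)))ᵀ * J.map (PadicInt.toZMod (p := ℓ)) *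
      X.map (PadicInt.toZMod (p := ℓ)) + (X.map (PadicInt.toZMod (p := ℓ)))ᵀ *
      J.map (PadicInt.toZMod (p := ℓ)) * (N σ).map (PadicInt.toZMod (p := ℓ)) = 0 := by
    have h : ((N σ)ᵀ * J * X + Xᵀ * J * N σ).map (PadicInt.toZMod (p := ℓ)) = 0 := by
      rw [hW]
      have h1 := map_toZMod_smul_pow (le_refl 1) (ν σ • F -
        ((ρ₂ σ : GL (Fin n) ℤ_[ℓ]) : Matrix (Fin n) (Fin n) ℤ_[ℓ])ᵀ * F *
          ((ρ₂ σ : GL (Fin n) ℤ_[ℓ]) : Matrix (Fin n) (Fin n) ℤ_[ℓ]) -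
        ((ℓ : ℤ_[ℓ]) ^ s) • ((N σ)ᵀ * J * N σ))
      rwa [pow_one] at h1
    rwa [Matrix.map_add _ (map_add _), Matrix.map_mul, Matrix.map_mul, Matrix.map_mul, Matrix.map_mul,
      Matrix.transpose_map, Matrix.transpose_map] at h
  -- the inverse of `X̄`
  set Xi : Matrix (Fin n) (Fin n) (ZMod ℓ) := ((((ρ₂ σ)⁻¹ : GL (Fin n) ℤ_[ℓ]) : Matrix (Fin n) (Fin n) ℤ_[ℓ]) *
    ((P⁻¹ : GL (Fin n) ℤ_[ℓ]) : Matrix (Fin n) (Fin n) ℤ_[ℓ])).map (PadicInt.toZMod (p := ℓ)) with hXi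
  clear_value Xi
  have hXXi : X.map (PadicInt.toZMod (p := ℓ)) * Xi = 1 := by
    rw [hXi, hX, ← Matrix.map_mul]
    have h1 : (P : Matrix (Fin n) (Fin n) ℤ_[ℓ]) * ((ρ₂ σ : GL (Fin n) ℤ_[ℓ]) : Matrix (Fin n) (Fin n) ℤ_[ℓ]) *
        ((((ρ₂ σ)⁻¹ : GL (Fin n) ℤ_[ℓ]) : Matrix (Fin n) (Fin n) ℤ_[ℓ]) *
          ((P⁻¹ : GL (Fin n) ℤ_[ℓ]) : Matrix (Fin n) (Fin n) ℤ_[ℓ])) = 1 := by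
      rw [Matrix.mul_assoc, Units.mul_inv_cancel_left, Units.mul_inv]
    rw [h1, Matrix.map_one _ (map_zero _) (map_one _)]
  have hXiXt : Xiᵀ * (X.map (PadicInt.toZMod (p := ℓ)))ᵀ = 1 := by
    rw [← Matrix.transpose_mul, hXXi, Matrix.transpose_one]
  -- conclude
  rw [mem_spLie_iff, Matrix.mul_assoc (N σ), Matrix.map_mul, ← hXi, Matrix.transpose_mul]
  calc Xiᵀ * ((N σ).map (PadicInt.toZMod (p := ℓ)))ᵀ * J.map (PadicInt.toZMod (p := ℓ)) +
        J.map (PadicInt.toZMod (p := ℓ)) * ((N σ).map (PadicInt.toZMod (p := ℓ)) * Xi)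
      = Xiᵀ * ((N σ).map (PadicInt.toZMod (p := ℓ)))ᵀ * J.map (PadicInt.toZMod (p := ℓ)) *
          (X.map (PadicInt.toZMod (p := ℓ)) * Xi) +
        Xiᵀ * (X.map (PadicInt.toZMod (p := ℓ)))ᵀ * J.map (PadicInt.toZMod (p := ℓ)) *
          ((N σ).map (PadicInt.toZMod (p := ℓ)) * Xi) := by
        rw [hXXi, hXiXt, Matrix.mul_one, Matrix.one_mul]
    _ = Xiᵀ * (((N σ).map (PadicInt.toZMod (p := ℓ)))ᵀ * J.map (PadicInt.toZMod (p := ℓ)) *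
          X.map (PadicInt.toZMod (p := ℓ)) + (X.map (PadicInt.toZMod (p := ℓ)))ᵀ *
          J.map (PadicInt.toZMod (p := ℓ)) * (N σ).map (PadicInt.toZMod (p := ℓ))) * Xi := by
        simp only [Matrix.mul_add, Matrix.add_mul, Matrix.mul_assoc]
    _ = 0 := by rw [hWb, Matrix.mul_zero, Matrix.zero_mul]

end SpValued

/-! ### One step of the symplectic induction -/

section SpStep

variable {ℓ : ℕ} [Fact ℓ.Prime] {Γ : Type} [Group Γ] [TopologicalSpace Γ] {n : ℕ}

/-- **One step of the correctness proof of Algorithm 2.4.1 in the symplectic case** ([BPPTVY,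
Remark 2.4.2], typed with equal multipliers): from `P` with `ρ₁ P ≡ P ρ₂ (mod ℓ^r)` and
`Pᵀ J P ≡ λ J (mod ℓ^{r+1})` — so that the deviation cocycle is `𝔰𝔭(J̄)`-valued
(`sp_deviation_mem_spLie`) and, by `complete`/`traces`, a coboundary `a - ρ̄aρ̄⁻¹`
(`stage_coboundary`) with `a ∈ 𝔤𝔰𝔭(J̄)` (`exists_transpose_mul_add_mul_eq_smul`) — one constructs a
lift `A = A₀ + ℓ A₁` of `a` such that `P' = (1 + ℓ^r A) P` satisfies `ρ₁ P' ≡ P' ρ₂ (mod ℓ^{r+1})`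
(Lemma 2.3.6(b), `stage_conj`) AND `P'ᵀ J P' ≡ λ' J (mod ℓ^{r+2})`; the correction `A₁` solves
`A₁ᵀ J̄ + J̄ A₁ = G` for an explicit alternating `G` (`exists_transpose_mul_add_mul_eq`).
[cite: BrumerEtAl2019, Algorithm 2.4.1 pp. 1156–1157, Lemma 2.3.20 and Remark 2.4.2 p. 1156] -/
theorem sp_step (hn : 0 < n) (ρ₁ ρ₂ : Γ →* GL (Fin n) ℤ_[ℓ])
    (hc₁ : Continuous fun σ => ((ρ₁ σ : GL (Fin n) ℤ_[ℓ]) : Matrix (Fin n) (Fin n) ℤ_[ℓ]))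
    (hc₂ : Continuous fun σ => ((ρ₂ σ : GL (Fin n) ℤ_[ℓ]) : Matrix (Fin n) (Fin n) ℤ_[ℓ]))
    (hc₂' : Continuous fun σ => (((ρ₂ σ)⁻¹ : GL (Fin n) ℤ_[ℓ]) : Matrix (Fin n) (Fin n) ℤ_[ℓ]))
    (I T : Set Γ) (hirr : IsAbsIrreducible (residual ρ₁)) (hI : ∀ σ ∈ I, ρ₁ σ = 1 ∧ ρ₂ σ = 1)
    (J : Matrix (Fin n) (Fin n) ℤ_[ℓ]) (hJ : IsUnit J.det) (hJt : Jᵀ = -J) (hJd : ∀ i, J i i = 0) (ν : Γ → ℤ_[ℓ])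
    (hν₁ : ∀ σ, ((ρ₁ σ : GL (Fin n) ℤ_[ℓ]) : Matrix (Fin n) (Fin n) ℤ_[ℓ])ᵀ * J * ((ρ₁ σ : GL (Fin n) ℤ_[ℓ]) : Matrix (Fin n) (Fin n) ℤ_[ℓ]) = ν σ • J)
    (hν₂ : ∀ σ, ((ρ₂ σ : GL (Fin n) ℤ_[ℓ]) : Matrix (Fin n) (Fin n) ℤ_[ℓ])ᵀ * J * ((ρ₂ σ : GL (Fin n) ℤ_[ℓ]) : Matrix (Fin n) (Fin n) ℤ_[ℓ]) = ν σ • J)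
    (complete : ∀ μ : Γ → Matrix (Fin n) (Fin n) (ZMod ℓ), IsLocallyConstant μ → (∀ σ ∈ I, μ σ = 0) →
      ValuedIn (spLie (J.map (PadicInt.toZMod (p := ℓ)))) μ →
      IsDeviationCocycle (residual ρ₁) μ → IsObstructing (residual ρ₁) μ →
      ∃ σ ∈ T, IsObstructingElt (residual ρ₁) μ σ)
    (traces : ∀ σ ∈ T, ((ρ₁ σ : GL (Fin n) ℤ_[ℓ]) : Matrix (Fin n) (Fin n) ℤ_[ℓ]).trace = ((ρ₂ σ : GL (Fin n) ℤ_[ℓ]) : Matrix (Fin n) (Fin n) ℤ_[ℓ]).trace)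
    {r : ℕ} (hr : 1 ≤ r) (P : GL (Fin n) ℤ_[ℓ]) (N : Γ → Matrix (Fin n) (Fin n) ℤ_[ℓ])
    (hN : ∀ σ, ((ρ₁ σ : GL (Fin n) ℤ_[ℓ]) : Matrix (Fin n) (Fin n) ℤ_[ℓ]) * P - P * ((ρ₂ σ : GL (Fin n) ℤ_[ℓ]) : Matrix (Fin n) (Fin n) ℤ_[ℓ]) =
      ((ℓ : ℤ_[ℓ]) ^ r) • N σ)
    (lam : ℤ_[ℓ]) (F : Matrix (Fin n) (Fin n) ℤ_[ℓ]) (hPJ : (P : Matrix (Fin n) (Fin n) ℤ_[ℓ])ᵀ * J * P = lam • J + ((ℓ : ℤ_[ℓ]) ^ (r + 1)) • F) :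
    ∃ (P' : GL (Fin n) ℤ_[ℓ]) (N' : Γ → Matrix (Fin n) (Fin n) ℤ_[ℓ]) (lam' : ℤ_[ℓ]) (F' : Matrix (Fin n) (Fin n) ℤ_[ℓ]),
      (∀ σ, ((ρ₁ σ : GL (Fin n) ℤ_[ℓ]) : Matrix (Fin n) (Fin n) ℤ_[ℓ]) * P' - P' * ((ρ₂ σ : GL (Fin n) ℤ_[ℓ]) : Matrix (Fin n) (Fin n) ℤ_[ℓ]) =
        ((ℓ : ℤ_[ℓ]) ^ (r + 1)) • N' σ) ∧
      (P' : Matrix (Fin n) (Fin n) ℤ_[ℓ])ᵀ * J * P' = lam' • J + ((ℓ : ℤ_[ℓ]) ^ (r + 1 + 1)) • F' := by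
  obtain ⟨s, rfl⟩ : ∃ s, r = s + 1 := ⟨r - 1, by omega⟩
  -- 1. the conjugate `ρ₂' = P ρ₂ P⁻¹`
  set ρ₂' : Γ →* GL (Fin n) ℤ_[ℓ] := (MulAut.conj P).toMonoidHom.comp ρ₂ with hρ₂'def
  have hρ₂' : ∀ σ, ρ₂' σ = P * ρ₂ σ * P⁻¹ := fun σ => rfl
  have hinv : ∀ σ, (ρ₂' σ)⁻¹ = P * (ρ₂ σ)⁻¹ * P⁻¹ := fun σ => by
    rw [hρ₂', _root_.mul_inv_rev, _root_.mul_inv_rev, inv_inv, mul_assoc]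
  have hE : ∀ σ, ((ρ₁ σ : GL (Fin n) ℤ_[ℓ]) : Matrix (Fin n) (Fin n) ℤ_[ℓ]) - ((ρ₂' σ : GL (Fin n) ℤ_[ℓ]) : Matrix (Fin n) (Fin n) ℤ_[ℓ]) =
      ((ℓ : ℤ_[ℓ]) ^ (s + 1)) • (N σ * ((P⁻¹ : GL (Fin n) ℤ_[ℓ]) : Matrix (Fin n) (Fin n) ℤ_[ℓ])) := by
    intro σ
    rw [← smul_mul_assoc, ← hN σ, hρ₂', Units.val_mul, Units.val_mul, Matrix.sub_mul,
      Units.mul_inv_cancel_right]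
  have hc₂'c : Continuous fun σ => ((ρ₂' σ : GL (Fin n) ℤ_[ℓ]) : Matrix (Fin n) (Fin n) ℤ_[ℓ]) := by
    simp only [hρ₂', Units.val_mul]
    exact (continuous_const.mul hc₂).mul continuous_const
  have hc₂'i : Continuous fun σ => (((ρ₂' σ)⁻¹ : GL (Fin n) ℤ_[ℓ]) : Matrix (Fin n) (Fin n) ℤ_[ℓ]) := by
    simp only [hinv, Units.val_mul]
    exact (continuous_const.mul hc₂').mul continuous_const
  have hI' : ∀ σ ∈ I, ρ₁ σ = 1 ∧ ρ₂' σ = 1 := fun σ hσ =>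
    ⟨(hI σ hσ).1, by rw [hρ₂', (hI σ hσ).2, mul_one, mul_inv_cancel]⟩
  have htr' : ∀ σ ∈ T, ((ρ₁ σ : GL (Fin n) ℤ_[ℓ]) : Matrix (Fin n) (Fin n) ℤ_[ℓ]).trace = ((ρ₂' σ : GL (Fin n) ℤ_[ℓ]) : Matrix (Fin n) (Fin n) ℤ_[ℓ]).trace :=
    fun σ hσ => by rw [traces σ hσ, hρ₂', Units.val_mul, Units.val_mul, Matrix.trace_units_conj]
  -- 2. the deviation cocycle is `𝔰𝔭(J̄)`-valued
  have hV : ∀ σ, (N σ * ((P⁻¹ : GL (Fin n) ℤ_[ℓ]) : Matrix (Fin n) (Fin n) ℤ_[ℓ]) * (((ρ₂' σ)⁻¹ : GL (Fin n) ℤ_[ℓ]) : Matrix (Fin n) (Fin n) ℤ_[ℓ])).map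
      (PadicInt.toZMod (p := ℓ)) ∈ spLie (J.map (PadicInt.toZMod (p := ℓ))) := by
    intro σ
    have h : N σ * ((P⁻¹ : GL (Fin n) ℤ_[ℓ]) : Matrix (Fin n) (Fin n) ℤ_[ℓ]) * (((ρ₂' σ)⁻¹ : GL (Fin n) ℤ_[ℓ]) : Matrix (Fin n) (Fin n) ℤ_[ℓ]) =
        N σ * (((ρ₂ σ)⁻¹ : GL (Fin n) ℤ_[ℓ]) : Matrix (Fin n) (Fin n) ℤ_[ℓ]) * ((P⁻¹ : GL (Fin n) ℤ_[ℓ]) : Matrix (Fin n) (Fin n) ℤ_[ℓ]) := by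
      rw [hinv, Units.val_mul, Units.val_mul]
      simp only [Matrix.mul_assoc, Units.inv_mul_cancel_left]
    rw [h]
    exact sp_deviation_mem_spLie ρ₁ ρ₂ P hr N hN J ν hν₁ hν₂ lam F hPJ σ
  -- 3. hence a coboundary `a - ρ̄ a ρ̄⁻¹`
  obtain ⟨a, ha⟩ := stage_coboundary ρ₁ ρ₂' _ hE hr hc₁ hc₂'c hc₂'i I T hirr hI'
    (spLie (J.map (PadicInt.toZMod (p := ℓ)))) complete htr' hV
  -- 4. `a ∈ 𝔤𝔰𝔭(J̄)`
  have hspan := (Literature.RepresentationTheory.Semisimple.span_eq_top_iff_forall_isIrreducible hn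
    (residual ρ₁)).2 hirr
  have hJb : IsUnit (J.map (PadicInt.toZMod (p := ℓ))).det := by
    have h := hJ.map (PadicInt.toZMod (p := ℓ))
    rwa [RingHom.map_det, RingHom.mapMatrix_apply] at h
  have hνb : ∀ σ, ((residual ρ₁ σ : GL (Fin n) (ZMod ℓ)) : Matrix (Fin n) (Fin n) (ZMod ℓ))ᵀ * J.map (PadicInt.toZMod (p := ℓ)) *
      ((residual ρ₁ σ : GL (Fin n) (ZMod ℓ)) : Matrix (Fin n) (Fin n) (ZMod ℓ)) = PadicInt.toZMod (ν σ) • J.map (PadicInt.toZMod (p := ℓ)) := by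
    intro σ
    have h : (((ρ₁ σ : GL (Fin n) ℤ_[ℓ]) : Matrix (Fin n) (Fin n) ℤ_[ℓ])ᵀ * J * ((ρ₁ σ : GL (Fin n) ℤ_[ℓ]) : Matrix (Fin n) (Fin n) ℤ_[ℓ])).map
        (PadicInt.toZMod (p := ℓ)) = (ν σ • J).map (PadicInt.toZMod (p := ℓ)) := by rw [hν₁ σ]
    rwa [Matrix.map_mul, Matrix.map_mul, Matrix.transpose_map, ← residual_apply_coe,
      Matrix.map_smul' _ _ _ (map_mul _)] at h
  have hab : ∀ σ, (a - ((residual ρ₁ σ : GL (Fin n) (ZMod ℓ)) : Matrix (Fin n) (Fin n) (ZMod ℓ)) * a *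
        (((residual ρ₁ σ)⁻¹ : GL (Fin n) (ZMod ℓ)) : Matrix (Fin n) (Fin n) (ZMod ℓ)))ᵀ * J.map (PadicInt.toZMod (p := ℓ)) +
      J.map (PadicInt.toZMod (p := ℓ)) * (a - ((residual ρ₁ σ : GL (Fin n) (ZMod ℓ)) : Matrix (Fin n) (Fin n) (ZMod ℓ)) * a *
        (((residual ρ₁ σ)⁻¹ : GL (Fin n) (ZMod ℓ)) : Matrix (Fin n) (Fin n) (ZMod ℓ))) = 0 := by
    intro σ
    have h := hV σ
    rw [mem_spLie_iff, ha σ] at h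
    exact h
  obtain ⟨cb, hcb⟩ := exists_transpose_mul_add_mul_eq_smul (residual ρ₁) hspan _ hJb
    (fun σ => PadicInt.toZMod (ν σ)) hνb a hab
  -- 5. the lift `A = A₀ + ℓ A₁`
  obtain ⟨A₀, hA₀⟩ := exists_map_toZMod_eq a
  obtain ⟨c, hcc⟩ : ∃ c : ℤ_[ℓ], PadicInt.toZMod c = cb :=
    ⟨((cb.val : ℕ) : ℤ_[ℓ]), by rw [map_natCast, ZMod.natCast_zmod_val]⟩
  obtain ⟨F₀, hF₀⟩ : ∃ F₀ : Matrix (Fin n) (Fin n) ℤ_[ℓ], A₀ᵀ * J + J * A₀ - c • J = (ℓ : ℤ_[ℓ]) • F₀ := by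
    apply exists_eq_smul_of_map_toZMod_eq_zero
    rw [Matrix.map_sub _ (map_sub _), Matrix.map_add _ (map_add _), Matrix.map_mul, Matrix.map_mul,
      Matrix.transpose_map, hA₀, Matrix.map_smul' _ _ _ (map_mul _), hcc, hcb, sub_self]
  obtain ⟨UJ, hUJ⟩ := exists_eq_sub_transpose J hJt hJd
  obtain ⟨U₀, hU₀⟩ : ∃ U₀ : Matrix (Fin n) (Fin n) (ZMod ℓ), F₀.map (PadicInt.toZMod (p := ℓ)) = U₀ - U₀ᵀ := by
    apply exists_map_eq_sub_transpose (m := 1) F₀ (A₀ᵀ * UJ + UJ * A₀ - c • UJ)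
    rw [pow_one, ← hF₀, hUJ, Matrix.transpose_sub, Matrix.transpose_add, Matrix.transpose_mul,
      Matrix.transpose_mul, Matrix.transpose_transpose, Matrix.transpose_smul, Matrix.mul_sub,
      Matrix.sub_mul, smul_sub]
    abel
  obtain ⟨UF, hUF⟩ : ∃ UF : Matrix (Fin n) (Fin n) (ZMod ℓ), F.map (PadicInt.toZMod (p := ℓ)) = UF - UFᵀ := by
    apply exists_map_eq_sub_transpose (m := s + 1 + 1) F ((P : Matrix (Fin n) (Fin n) ℤ_[ℓ])ᵀ * UJ * P - lam • UJ)
    have h : ((ℓ : ℤ_[ℓ]) ^ (s + 1 + 1)) • F = (P : Matrix (Fin n) (Fin n) ℤ_[ℓ])ᵀ * J * P - lam • J := by rw [hPJ]; abel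
    rw [h, hUJ, transpose_mul_sub_transpose_mul, Matrix.transpose_sub, Matrix.transpose_smul, smul_sub]
    abel
  -- reductions of `P`
  set Pb : Matrix (Fin n) (Fin n) (ZMod ℓ) := (P : Matrix (Fin n) (Fin n) ℤ_[ℓ]).map (PadicInt.toZMod (p := ℓ)) with hPb
  set Pbi : Matrix (Fin n) (Fin n) (ZMod ℓ) := ((P⁻¹ : GL (Fin n) ℤ_[ℓ]) : Matrix (Fin n) (Fin n) ℤ_[ℓ]).map (PadicInt.toZMod (p := ℓ)) with hPbi
  clear_value Pb Pbi
  have hPbi1 : Pbi * Pb = 1 := by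
    rw [hPb, hPbi, ← Matrix.map_mul, Units.inv_mul, Matrix.map_one _ (map_zero _) (map_one _)]
  have hPbT : Pbᵀ * Pbiᵀ = 1 := by rw [← Matrix.transpose_mul, hPbi1, Matrix.transpose_one]
  -- the correction `A₁`
  set UJb : Matrix (Fin n) (Fin n) (ZMod ℓ) := UJ.map (PadicInt.toZMod (p := ℓ)) with hUJb
  clear_value UJb
  have hJb' : J.map (PadicInt.toZMod (p := ℓ)) = UJb - UJbᵀ := by
    rw [hUJ, Matrix.map_sub _ (map_sub _), Matrix.transpose_map, hUJb]
  set t : ZMod ℓ := PadicInt.toZMod ((ℓ : ℤ_[ℓ]) ^ s) with ht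
  set V : Matrix (Fin n) (Fin n) (ZMod ℓ) := Pbiᵀ * UF * Pbi with hVdef
  clear_value V
  have hV1 : Pbᵀ * V * Pb = UF := by
    rw [hVdef, ← Matrix.mul_assoc, ← Matrix.mul_assoc, hPbT, Matrix.one_mul, Matrix.mul_assoc, hPbi1,
      Matrix.mul_one]
  have hV2 : Pbᵀ * Vᵀ * Pb = UFᵀ := by
    rw [← hV1, Matrix.transpose_mul, Matrix.transpose_mul, Matrix.transpose_transpose, Matrix.mul_assoc]
  set U₁ : Matrix (Fin n) (Fin n) (ZMod ℓ) := -V - U₀ - t • (aᵀ * UJb * a) with hU₁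
  have hJbt : (J.map (PadicInt.toZMod (p := ℓ)))ᵀ = -J.map (PadicInt.toZMod (p := ℓ)) := by
    rw [hJb', Matrix.transpose_sub, Matrix.transpose_transpose, neg_sub]
  obtain ⟨a₁, ha₁⟩ := exists_transpose_mul_add_mul_eq (J.map (PadicInt.toZMod (p := ℓ)))
    (J.map (PadicInt.toZMod (p := ℓ)))⁻¹ U₁ (Matrix.mul_nonsing_inv _ hJb) hJbt
  obtain ⟨A₁, hA₁⟩ := exists_map_toZMod_eq a₁
  set A : Matrix (Fin n) (Fin n) ℤ_[ℓ] := A₀ + (ℓ : ℤ_[ℓ]) • A₁ with hAdef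
  have hA : A.map (PadicInt.toZMod (p := ℓ)) = a := by
    have h0 : ((ℓ : ℤ_[ℓ]) • A₁).map (PadicInt.toZMod (p := ℓ)) = 0 := by
      have h := map_toZMod_smul_pow (le_refl 1) A₁
      rwa [pow_one] at h
    rw [hAdef, Matrix.map_add _ (map_add _), hA₀, h0, add_zero]
  have I0 : Aᵀ * J + J * A = c • J + (ℓ : ℤ_[ℓ]) • (F₀ + (A₁ᵀ * J + J * A₁)) := by
    rw [smul_add, ← hF₀, hAdef, Matrix.transpose_add, Matrix.transpose_smul, Matrix.add_mul, Matrix.mul_add,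
      Matrix.smul_mul, Matrix.mul_smul, smul_add]
    abel
  -- 6. `Q = 1 + ℓ^r A` and `P' = Q P`
  obtain ⟨Q, hQ⟩ := isUnit_one_add_smul_pow hr A
  choose Nc hNc using stage_conj ρ₁ ρ₂' _ hE hr a ha A hA
  set B : Matrix (Fin n) (Fin n) ℤ_[ℓ] := F + (((ℓ : ℤ_[ℓ]) ^ (s + 1)) * c) • F + ((P : Matrix (Fin n) (Fin n) ℤ_[ℓ])ᵀ * F₀ * P +
      (P : Matrix (Fin n) (Fin n) ℤ_[ℓ])ᵀ * (A₁ᵀ * J + J * A₁) * P) + ((ℓ : ℤ_[ℓ]) ^ s) • ((P : Matrix (Fin n) (Fin n) ℤ_[ℓ])ᵀ * (Aᵀ * J * A) * P) with hBdef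
  clear_value B
  -- (I3) `B ≡ 0 (mod ℓ)`
  have hBmap : B.map (PadicInt.toZMod (p := ℓ)) = 0 := by
    set φ := (PadicInt.toZMod (p := ℓ)).mapMatrix (m := Fin n) with hφ
    have hφapp : ∀ M : Matrix (Fin n) (Fin n) ℤ_[ℓ], M.map (PadicInt.toZMod (p := ℓ)) = φ M := fun M => (RingHom.mapMatrix_apply _ _).symm
    have hφsmul : ∀ (x : ℤ_[ℓ]) (M : Matrix (Fin n) (Fin n) ℤ_[ℓ]), φ (x • M) = PadicInt.toZMod x • φ M := fun x M => by
      rw [← hφapp, ← hφapp, Matrix.map_smul' _ _ _ (map_mul _)]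
    have hφT : ∀ M : Matrix (Fin n) (Fin n) ℤ_[ℓ], φ Mᵀ = (φ M)ᵀ := fun M => by rw [← hφapp, ← hφapp, Matrix.transpose_map]
    have hφP : φ (P : Matrix (Fin n) (Fin n) ℤ_[ℓ]) = Pb := by rw [← hφapp, hPb]
    have hφA : φ A = a := by rw [← hφapp, hA]
    have hφA₁ : φ A₁ = a₁ := by rw [← hφapp, hA₁]
    have hφJ : φ J = UJb - UJbᵀ := by rw [← hφapp, hJb']
    have hφF : φ F = UF - UFᵀ := by rw [← hφapp, hUF]
    have hφF₀ : φ F₀ = U₀ - U₀ᵀ := by rw [← hφapp, hU₀]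
    have hsc : PadicInt.toZMod (p := ℓ) (((ℓ : ℤ_[ℓ]) ^ (s + 1)) * c) = 0 := by
      rw [map_mul, toZMod_ell_pow (by omega), zero_mul]
    have ha₁' : a₁ᵀ * (UJb - UJbᵀ) + (UJb - UJbᵀ) * a₁ = U₁ - U₁ᵀ := by rw [← hJb']; exact ha₁
    rw [hφapp, hBdef]
    simp only [map_add, map_mul, hφsmul, hφT, hφP, hφA, hφA₁, hφJ, hφF, hφF₀, hsc, zero_smul, add_zero, ← ht]
    rw [ha₁', hU₁]
    simp only [Matrix.transpose_sub, Matrix.transpose_neg, Matrix.transpose_smul, Matrix.transpose_mul,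
      Matrix.transpose_transpose, Matrix.mul_sub, Matrix.sub_mul, Matrix.mul_neg, Matrix.neg_mul,
      Matrix.mul_smul, Matrix.smul_mul, smul_sub, hV1, hV2]
    simp only [Matrix.mul_assoc]
    module
  obtain ⟨F', hF'⟩ := exists_eq_smul_of_map_toZMod_eq_zero B hBmap
  refine ⟨Q * P, fun σ => Nc σ * (P : Matrix (Fin n) (Fin n) ℤ_[ℓ]), lam + ((ℓ : ℤ_[ℓ]) ^ (s + 1)) * c * lam, F', fun σ => ?_, ?_⟩
  · -- `ρ₁ (QP) - (QP) ρ₂ = (ρ₁ Q - Q ρ₂') P`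
    have hfac : ((ρ₁ σ : GL (Fin n) ℤ_[ℓ]) : Matrix (Fin n) (Fin n) ℤ_[ℓ]) * ((Q * P : GL (Fin n) ℤ_[ℓ]) : Matrix (Fin n) (Fin n) ℤ_[ℓ]) -
        ((Q * P : GL (Fin n) ℤ_[ℓ]) : Matrix (Fin n) (Fin n) ℤ_[ℓ]) * ((ρ₂ σ : GL (Fin n) ℤ_[ℓ]) : Matrix (Fin n) (Fin n) ℤ_[ℓ]) =
        (((ρ₁ σ : GL (Fin n) ℤ_[ℓ]) : Matrix (Fin n) (Fin n) ℤ_[ℓ]) * (1 + ((ℓ : ℤ_[ℓ]) ^ (s + 1)) • A) -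
          (1 + ((ℓ : ℤ_[ℓ]) ^ (s + 1)) • A) * ((ρ₂' σ : GL (Fin n) ℤ_[ℓ]) : Matrix (Fin n) (Fin n) ℤ_[ℓ])) * (P : Matrix (Fin n) (Fin n) ℤ_[ℓ]) := by
      simp only [hρ₂', Units.val_mul, hQ, Matrix.sub_mul, Matrix.mul_assoc, Units.inv_mul, Matrix.mul_one]
    rw [hfac, hNc σ, smul_mul_assoc]
  · -- (I1) `P'ᵀ J P' = λ' J + ℓ^{r+1} B`
    have I2 : (1 + ((ℓ : ℤ_[ℓ]) ^ (s + 1)) • A)ᵀ * J * (1 + ((ℓ : ℤ_[ℓ]) ^ (s + 1)) • A) =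
        J + ((ℓ : ℤ_[ℓ]) ^ (s + 1)) • (Aᵀ * J + J * A) +
          (((ℓ : ℤ_[ℓ]) ^ (s + 1)) * ((ℓ : ℤ_[ℓ]) ^ (s + 1))) • (Aᵀ * J * A) := by
      rw [Matrix.transpose_add, Matrix.transpose_one, Matrix.transpose_smul]
      simp only [Matrix.add_mul, Matrix.mul_add, Matrix.smul_mul, Matrix.mul_smul, Matrix.one_mul,
        Matrix.mul_one, smul_add, smul_smul]
      module
    have hmain : ((Q * P : GL (Fin n) ℤ_[ℓ]) : Matrix (Fin n) (Fin n) ℤ_[ℓ])ᵀ * J * ((Q * P : GL (Fin n) ℤ_[ℓ]) : Matrix (Fin n) (Fin n) ℤ_[ℓ]) =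
        (P : Matrix (Fin n) (Fin n) ℤ_[ℓ])ᵀ * ((1 + ((ℓ : ℤ_[ℓ]) ^ (s + 1)) • A)ᵀ * J * (1 + ((ℓ : ℤ_[ℓ]) ^ (s + 1)) • A)) * (P : Matrix (Fin n) (Fin n) ℤ_[ℓ]) := by
      rw [Units.val_mul, hQ, Matrix.transpose_mul]
      simp only [Matrix.mul_assoc]
    have hrhs : ((ℓ : ℤ_[ℓ]) ^ (s + 1 + 1 + 1)) • F' = ((ℓ : ℤ_[ℓ]) ^ (s + 1 + 1)) • B := by
      rw [hF', smul_smul, ← pow_succ]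
    rw [hrhs, hmain, I2, I0]
    simp only [Matrix.mul_add, Matrix.add_mul, Matrix.mul_smul, Matrix.smul_mul, smul_add, smul_smul]
    rw [hPJ, hBdef]
    simp only [Matrix.mul_add, Matrix.add_mul, smul_add, smul_smul]
    module

end SpStep

/-! ### The criterion for `G = GSp(J)` -/

section GSp

/-- **[BPPTVY, Thm. 2.1.5 / Algorithm 2.4.1 with Lemma 2.3.20 and Remark 2.4.2] holds for `G = GSp(J)`**
(discharge of the named fact `traceEq_of_faltingsSerre_symplectic`, the form used for `GSp₄(𝔽₂)` in
[BPPTVY, §§5–7] and by `paramodular_of_surfaceCertificate` / `paramodular_277`).  Same induction as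
`traceEq_of_faltingsSerre_holds`, carrying in addition `Pᵀ J P ≡ λ J (mod ℓ^{r+1})` so that every
deviation cocycle met is `𝔰𝔭(J̄)`-valued and only the WEAKER completeness binder is needed
(`sp_step`).  Rank `0` is trivial. [cite: BrumerEtAl2019, Thm. 2.1.5 p. 1150; Algorithm 2.4.1 pp. 1156–1157; Lemma 2.3.20 and Remark 2.4.2 p. 1156; (5.1.2)–(5.1.4) p. 1173] -/
theorem traceEq_of_faltingsSerre_symplectic_holds : traceEq_of_faltingsSerre_symplectic := by
  intro ℓ _ Γ _ _ _ n ρ₁ ρ₂ h₁ h₂ I T J hJ hJt hJd ν hν₁ hν₂ h0 hirr hI complete traces σ₀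
  rcases Nat.eq_zero_or_pos n with rfl | hn
  · exact congrArg Matrix.trace (Subsingleton.elim _ _)
  have hc₁ : Continuous fun σ => ((ρ₁ σ : GL (Fin n) ℤ_[ℓ]) : Matrix (Fin n) (Fin n) ℤ_[ℓ]) :=
    Units.continuous_val.comp h₁
  have hc₂ : Continuous fun σ => ((ρ₂ σ : GL (Fin n) ℤ_[ℓ]) : Matrix (Fin n) (Fin n) ℤ_[ℓ]) :=
    Units.continuous_val.comp h₂
  have hc₂' : Continuous fun σ => (((ρ₂ σ)⁻¹ : GL (Fin n) ℤ_[ℓ]) : Matrix (Fin n) (Fin n) ℤ_[ℓ]) :=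
    Units.continuous_coe_inv.comp h₂
  have hν₁' : ∀ σ, ((ρ₁ σ : GL (Fin n) ℤ_[ℓ]) : Matrix (Fin n) (Fin n) ℤ_[ℓ])ᵀ * J *
      ((ρ₁ σ : GL (Fin n) ℤ_[ℓ]) : Matrix (Fin n) (Fin n) ℤ_[ℓ]) = ν σ • J := fun σ => hν₁ σ
  have hν₂' : ∀ σ, ((ρ₂ σ : GL (Fin n) ℤ_[ℓ]) : Matrix (Fin n) (Fin n) ℤ_[ℓ])ᵀ * J *
      ((ρ₂ σ : GL (Fin n) ℤ_[ℓ]) : Matrix (Fin n) (Fin n) ℤ_[ℓ]) = ν σ • J := fun σ => hν₂ σ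
  -- the induction: `ρ₁ P ≡ P ρ₂ (mod ℓ^r)` and `Pᵀ J P ≡ λ J (mod ℓ^{r+1})` for every `r ≥ 1`
  have good : ∀ r : ℕ, 1 ≤ r → ∃ (P : GL (Fin n) ℤ_[ℓ]) (N : Γ → Matrix (Fin n) (Fin n) ℤ_[ℓ])
      (lam : ℤ_[ℓ]) (F : Matrix (Fin n) (Fin n) ℤ_[ℓ]),
      (∀ σ, ((ρ₁ σ : GL (Fin n) ℤ_[ℓ]) : Matrix (Fin n) (Fin n) ℤ_[ℓ]) * P -
        P * ((ρ₂ σ : GL (Fin n) ℤ_[ℓ]) : Matrix (Fin n) (Fin n) ℤ_[ℓ]) = ((ℓ : ℤ_[ℓ]) ^ r) • N σ) ∧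
      (P : Matrix (Fin n) (Fin n) ℤ_[ℓ])ᵀ * J * (P : Matrix (Fin n) (Fin n) ℤ_[ℓ]) =
        lam • J + ((ℓ : ℤ_[ℓ]) ^ (r + 1)) • F := by
    intro r hr
    induction r, hr using Nat.le_induction with
    | base =>
      have hN : ∀ σ, ∃ N : Matrix (Fin n) (Fin n) ℤ_[ℓ],
          ((ρ₁ σ : GL (Fin n) ℤ_[ℓ]) : Matrix (Fin n) (Fin n) ℤ_[ℓ]) -
            ((ρ₂ σ : GL (Fin n) ℤ_[ℓ]) : Matrix (Fin n) (Fin n) ℤ_[ℓ]) = (ℓ : ℤ_[ℓ]) • N := by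
        intro σ
        apply exists_eq_smul_of_map_toZMod_eq_zero
        rw [Matrix.map_sub _ (map_sub _), ← residual_apply_coe, ← residual_apply_coe, h0, sub_self]
      choose N hN using hN
      refine ⟨1, N, 1, 0, fun σ => ?_, ?_⟩
      · rw [Units.val_one, Matrix.mul_one, Matrix.one_mul, pow_one, hN]
      · rw [Units.val_one, Matrix.transpose_one, Matrix.one_mul, Matrix.mul_one, one_smul, smul_zero, add_zero]
    | succ r hr ih =>
      obtain ⟨P, N, lam, F, hN, hPJ⟩ := ih
      exact sp_step hn ρ₁ ρ₂ hc₁ hc₂ hc₂' I T hirr hI J hJ hJt hJd ν hν₁' hν₂' complete traces hr P N hN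
        lam F hPJ
  -- conclusion: `tr ρ₁(σ₀) - tr ρ₂(σ₀)` is divisible by every power of `ℓ`
  have hmem : ∀ m : ℕ, ((ρ₁ σ₀ : GL (Fin n) ℤ_[ℓ]) : Matrix (Fin n) (Fin n) ℤ_[ℓ]).trace -
      ((ρ₂ σ₀ : GL (Fin n) ℤ_[ℓ]) : Matrix (Fin n) (Fin n) ℤ_[ℓ]).trace ∈ Ideal.span {(ℓ : ℤ_[ℓ]) ^ m} := by
    intro m
    rcases Nat.eq_zero_or_pos m with rfl | hm
    · rw [pow_zero, Ideal.span_singleton_one]; exact Submodule.mem_top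
    obtain ⟨P, N, -, -, hN, -⟩ := good m hm
    have hdiff : ((ρ₁ σ₀ : GL (Fin n) ℤ_[ℓ]) : Matrix (Fin n) (Fin n) ℤ_[ℓ]) -
        (P : Matrix (Fin n) (Fin n) ℤ_[ℓ]) * ((ρ₂ σ₀ : GL (Fin n) ℤ_[ℓ]) : Matrix (Fin n) (Fin n) ℤ_[ℓ]) *
          ((P⁻¹ : GL (Fin n) ℤ_[ℓ]) : Matrix (Fin n) (Fin n) ℤ_[ℓ]) =
        ((ℓ : ℤ_[ℓ]) ^ m) • (N σ₀ * ((P⁻¹ : GL (Fin n) ℤ_[ℓ]) : Matrix (Fin n) (Fin n) ℤ_[ℓ])) := by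
      rw [← smul_mul_assoc, ← hN σ₀, Matrix.sub_mul, Units.mul_inv_cancel_right]
    rw [← Matrix.trace_units_conj P ((ρ₂ σ₀ : GL (Fin n) ℤ_[ℓ]) : Matrix (Fin n) (Fin n) ℤ_[ℓ]),
      ← Matrix.trace_sub, hdiff, Matrix.trace_smul, smul_eq_mul]
    exact Ideal.mul_mem_right _ _ (Ideal.mem_span_singleton_self _)
  exact sub_eq_zero.1 (eq_zero_of_forall_mem_span_pow _ hmem)

end GSp

end Literature.NumberTheory.FaltingsSerre
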